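import Literature.MathematicalPhysics.QuantumFieldTheory.Balaban1983to89.Beta.VectorTailsSeam
import Literature.MathematicalPhysics.QuantumFieldTheory.Balaban1983to89.Beta.VectorLegVolumeAdapter
import Literature.MathematicalPhysics.QuantumFieldTheory.Balaban1983to89.Beta.ScalewiseVectorSeam
import Literature.MathematicalPhysics.QuantumFieldTheory.Balaban1983to89.Beta.AveragedAFCarrier

/-!
# Beta / AveragedAFCarrierVectorTails — the SCALAR WALL ROAD (an3 average-first table → an4 volume seam → an1 vector small-field legs)
# ON THE [III] SIDE: at the (α)-leaf target shape the END statement carries THE WHOLE LOCATED [III] LIST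
# (β sub-cell, [III]-side CO-LEAD unit `b2b-balaban-strat-b14` gen 15; BETA-SPEC §5.15 (c) / §5.21; RULING (R14-4)/(R14-6), (R16) ADDENDUM (c′) §7.32)
# v1.1 (same gen, APPEND-ONLY + one import): + §4 the [III] twin of an5's `VectorLegVolumeAdapter.endpointExistence_of_vectorTails_evenVolume` (beta-ref A-R313)
# v1.2 (same gen, APPEND-ONLY, no new import): + §5 the [III] twins of the scalar wall's BASE END forms (`SquareTable.endpointExistence_of_realisedTable`,
# `…_of_scalarBounds[_avg]`, `WallVolumeTransfer.…_of_scalarBounds[_avg]_vol`) — BETA-SPEC §5.21 (h) census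
# v1.3 DOCFIX (statements untouched): §4's docstring lists `hgen hhalt hcur` as structural / run-side, not one-loop data (XREAD C-lit3g16-1 I1)
# v1.4 (gen 16, APPEND-ONLY + one import `Beta.ScalewiseVectorSeam`): + §6 the [III] twins of the lead's EXIT-B socket on the vector road
# (`ScalewiseVectorSeam.endpointExistence_of_scalewise_vectorSeam[_of_symmetries]`, p185521; RULINGS (R17)/(R18-1))
# v1.5 (gen 17, APPEND-ONLY, no new import): + §7 the [III] twins of the lead's PRINTED-READ-OUT END forms (`ScalewiseVectorSeam` v1.2 §5, p186248:
# `endpointExistence_of_scalewise_vectorSeam_readout122[_of_symmetries]`; RULING (R20-3) «Fbal := the typed (1.22) read-out» BY NAME)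
# v1.6 (gen 17, APPEND-ONLY, no new import): + §8 RULINGS (R22)/(R23) on the vector road, [III] side, at the convention-free socket level: the averaged-AF
# CARRIER from the socket data + (D4) alone (lead `ScalewiseVectorSeam` v1.5 §7 drift, p186611), the END twin with (D5) = (C) only and the printed-type
# constant β′ DERIVED (an4 `DriftRemainder` v1.1 §6, p186633; twin of the lead's v1.6 `endpointExistence_of_scalewise_vectorSeam_cont`), the (D5)-free and (U)-free consumers
# v1.7 (gen 17, APPEND-ONLY, no new import): + §9 RULING (R21) on the [III] side — the twins IN THE KERNEL'S CONVENTION of the lead's `ScalewiseVectorSeam` v1.6 §8 (p187481):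
# `…_printed_flip` and SOCKET v2 `…_printed_flip_cont` (hW/hR asked of the FLIPPED one-step kernels `fun μ ν z => T j μ ν (−z)`; (D5) = (C); β′ derived), + the carrier and the
# (D5)-free and (U)-free consumers from `oneLoopDrift_of_scalewise_printed_flip`

HONEST FRAMING (page 1 of everything the β sub-cell writes): discharging `BetaPertH` makes Bałaban's UV stability UNCONDITIONAL — a
real constructive-QFT result; it is NOT the continuum limit and NOT the Clay problem.  THIS MODULE is CLASS-LEVEL BOOKKEEPING: it
composes LANDED kernel files — an3's `SquareTableAvgFirst` (the average-first scalar wall, drift level `oneLoopDrift_of_scalarBounds_avgFirst`),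
an4's `WallVolumeTransfer` (the volume seam `h0_avg_vol … d2x_vol`), an1's `VectorTailsPt`/`VectorTailsWindow`/`VectorTailsBlock`/`VectorTailsSeam`
(the vector small-field legs: `wall_rows_mod`, `hRows_of_gamma`, the labelled cyclic block, uniform weights) and this lineage's `AveragedAFCarrier`
v1.8 (carrier + consumers) — and asserts nothing printed by Bałaban; every statement is [folklore] bookkeeping over the cell's hypothesis
carriers.  The two PRINTED-WITH-PROOF U = 1 leaves `B5.Prop12Printed` / `B5.Kernel126_127Printed` ([Balaban1984PropagatorsI] Prop. 1.2 p. 35,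
(1.126)–(1.127) p. 38) enter BY NAME as binders exactly as in an1's file and are never discharged here.  The wall (BETA-SPEC §7.20 (T) /
§7.32, `BETA/WALL.md` v1.7) is UNTOUCHED; road-(1) verdict unchanged (PRECISELY WALLED at END-STATEMENT grade; nothing of (M2⁺) discharged);
value = census precision — the lead's (R16)-addendum binder check of an1's END theorem now holds with the [III] list as conclusion —,
NOT summit progress.

ABSOLUTE RULE (cell charter, verbatim): "No internally-minted statement may enter as a cited fact. Every hypothesis is either
kernel-proved in this package or a verbatim quotation of a PUBLISHED theorem with page reference. The manuscript(s) under audit are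
NOT citable for their own disputed steps — they are the thing under adjudication; programme-internal (2001/route/tribunal) claims
are never citable."

## What (one carrier + five END theorems, each a SHORT composition; binder blocks copied from the tree files)

For each source END theorem (conclusion `EndpointExistence Cn`, remainder clause `rr ≤ stepBal N Lc`) —
an3 `SquareTableAvgFirst.endpointExistence_of_scalarBounds_avgFirst` (§1), an4 `WallVolumeTransfer.endpointExistence_of_scalarBounds_avgFirst_vol` (§2),
an1 `VectorTailsSeam.endpointExistence_of_vectorTails_{vol,block,uniformBlock}` (§3) — the [III]-side twin `wallEND_…_allProfiles` takes THE SAME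
binders with EXACTLY these deltas: `(hhalt : HaltsOutside Cn β) (hcur : CurriesHBeta Cn β)` after `hgen`; `{rr γ₀ β' : ℝ}` ↦ `{rr γ₀ β' β₀ : ℝ}`;
`hr : rr ≤ stepBal N Lc` ↦ `hr : rr < stepBal N Lc` (the [III] list needs positive slope: `ConstRemainderConsumers.Margin.sum246_fails` at
equality); `hβ'` moved behind `hup`; tail `(hβ₀ : 0 < β₀) {L : ℕ} (hL2 : 2 ≤ L) (p : ℕ) {κ₀ : ℕ} (hκ : 6 ≤ κ₀)`; in §3 an1's section variables
`{τ} {κB | Λ} (Mv) [hMv] (a) (ha)` become explicit leading binders and the LABEL TYPE is renamed `L ↦ Λ` (the [III] side uses `L : ℕ` for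
[III]'s block-size parameter of `B14.IsRj` / `HorizonFacts`).  Conclusion everywhere:
`EndpointExistence Cn ∧ ∃ γ₁ > 0, ∀ γ ≤ min γ₀ γ₁, ∀ runs in ]0,γ], ∀ p′ ≤ p, ∀ A₀ ≥ 0: sizes (2.28)/(2.31) ∧ HorizonFacts` ((2.6)–(2.9) +
(2.46) of [Balaban1988Convergent] pp. 255–263).  Proofs: §1 = an3's DRIFT theorem → `betaAvgAFH_of_driftRemainderConst` →
`BetaAvgAFH.endpoint_and_flowControl_allProfiles`; §2 = §1 with an4's eight volume-transfer lemmas; §3 = §2 with an1's row suppliers, then the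
two instance specialisations — i.e. the SAME terms as the source files with the END socket swapped.

CENSUS READING (RULING (R16) + addendum (c′), BETA-SPEC §7.32; WALL.md v1.7 §4/§6): the binders of `wallEND_of_vectorTails_uniformBlock_allProfiles`
are EXACTLY — (α) `h12`, `h126` BY NAME (terminal printed-with-proof leaves); `hgrow` (a parameter choice); (D3-vol) `hG`/`hg`; (D3-Γ)
`h0S/h1S/h1×S/h2×S` (scalar-type suppliers); (D1) as `hU` + `hid` (instantiate `μC := fun j _ => S.β0 j`, `hid := rfl` ⟹ `hU` = (D1));
(D4) `hrem`/`hr`; (D5) `hcont`; `hup`, `hgen`/`hhalt`/`hcur`, table/window data, run-side data.  Nothing is discharged; NOT summit progress,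
never continuum / mass gap / Clay.
-/

namespace Literature.MathematicalPhysics.QuantumFieldTheory.Balaban1983to89.Beta.AveragedAFCarrierVectorTails

open _root_.Filter
open scoped _root_.Topology
open Literature.MathematicalPhysics.QuantumFieldTheory.Balaban1983to89
open Literature.MathematicalPhysics.QuantumFieldTheory.Balaban1983to89.Beta
open Literature.MathematicalPhysics.QuantumFieldTheory.Balaban1983to89.B5Prop11Plancherel (Tor fine)
open Literature.MathematicalPhysics.QuantumFieldTheory.Balaban1983to89.Beta.DyadicShell (Pt supNorm)
open Literature.MathematicalPhysics.QuantumFieldTheory.Balaban1983to89.Beta.BubbleTransfer (unitVec bubbleConst)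
open Literature.MathematicalPhysics.QuantumFieldTheory.Balaban1983to89.Beta.GhostTable (gFree)
open Literature.MathematicalPhysics.QuantumFieldTheory.Balaban1983to89.Beta.VectorTailsLoc (fam kfam)
open Literature.MathematicalPhysics.QuantumFieldTheory.Balaban1983to89.Beta.VectorTailsPt (GT blockSteps wall_rows_mod)
open Literature.MathematicalPhysics.QuantumFieldTheory.Balaban1983to89.Beta.VectorTailsBlock
  (X₀L lblock lshift lshift_mem_lblock_iff lwrapped_hX lblock_nonempty)
open Literature.MathematicalPhysics.QuantumFieldTheory.Balaban1983to89.Beta.VectorTailsWindow (GS Dvec Dvec_nonneg hRows_of_gamma)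
open Literature.MathematicalPhysics.QuantumFieldTheory.Balaban1983to89.Beta.VectorTailsSeam (uwt uwt_nonneg uwt_shift sum_uwt)
open Literature.MathematicalPhysics.QuantumFieldTheory.Balaban1983to89.Beta.WallVolumeTransfer
  (d0_avg_vol d1_avg_vol d1x_vol d2x_vol h0_avg_vol h1_avg_vol h1x_vol h2x_vol)
open FlowStep FlowStepRuns DagBinding B14DeltaBeta
open Literature.MathematicalPhysics.QuantumFieldTheory.Balaban1983to89.Beta.MarginalTelescoping (composedCoeff IdentityForm)
open Literature.MathematicalPhysics.QuantumFieldTheory.Balaban1983to89.Beta.RemainderChain (RemainderConst)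
open Literature.MathematicalPhysics.QuantumFieldTheory.Balaban1983to89.Beta.WindowIdentification (fullSum)
open Literature.MathematicalPhysics.QuantumFieldTheory.Balaban1983to89.Beta.SquareTable (stK bfCoeff bfP bfQ)
open Literature.MathematicalPhysics.QuantumFieldTheory.Balaban1983to89.Beta.SquareTableAvgFirst
  (AfIdx afCoeff afP afQ Rx Sx Rx' Sx' oneLoopDrift_of_scalarBounds_avgFirst)
open Literature.MathematicalPhysics.QuantumFieldTheory.Balaban1983to89.Beta.LargeLWindow.WindowDecomposition (constA)
open Literature.MathematicalPhysics.QuantumFieldTheory.Balaban1983to89.Beta.LeadingCoefficient (kappaBal transverseValue)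
open AveragedAFCarrier

noncomputable section

/-! ## §1 The average-first scalar wall (an3 `SquareTableAvgFirst`) on the [III] side -/

section AvgFirst

variable {μ ν : Fin 4} {κB : Type*}

/-- **THE AVERAGE-FIRST SCALAR WALL ⟹ THE CARRIER** (RULING (R14-4)/(R14-6): the THIRD official statement of the wall, average-first form).
The binders of an3's `SquareTableAvgFirst.oneLoopDrift_of_scalarBounds_avgFirst` verbatim (window data; convex weights + shift structure; ONE kernel
family `G_{n,b}` per base point with the EIGHT graded scalar bounds `h0/h1/h1×/h2×/d0/d1/d1×/d2×`; ONE full-sum comparison `hU` per scale;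
`IdentityForm`) + (D4) `RemainderConst S γ₀ rr` ⟹ `BetaAvgAFH (stepBal N Lc − rr) (2A″) γ₀ β`, `A″` = an3's drift constant verbatim
(`betaAvgAFH_of_driftRemainderConst` on the drift).  MISSING-B14 §9 Table 9.1: the SAME row as the (R13-3) wall. [folklore] -/
theorem betaAvgAFH_of_scalarBounds_avgFirst {β : HBeta} (S : B12Beta.OneLoopSplit β) (hμν : μ ≠ ν) {N : ℝ} (hN : N ≠ 0)
    {Lc : ℕ} (hL : 2 ≤ Lc) {μC : ℕ → ℕ → ℝ} {Bset : ℕ → Finset κB} {wt : ℕ → κB → ℝ} {sh : ℕ → Equiv.Perm κB}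
    {Gf : ℕ → κB → Pt → ℝ} {D A : ℕ → ℝ} (hD : ∀ j, 0 ≤ D j) (hA : ∀ j, 0 ≤ A j) {δ U cc : ℝ} {M : ℕ → ℕ} (hδ : 0 < δ)
    (hwt0 : ∀ n : ℕ, 2 ≤ n → ∀ b ∈ Bset n, 0 ≤ wt n b) (hwt1 : ∀ n : ℕ, 2 ≤ n → ∑ b ∈ Bset n, wt n b = 1)
    (hshB : ∀ n : ℕ, 2 ≤ n → ∀ b, sh n b ∈ Bset n ↔ b ∈ Bset n) (hwtsh : ∀ n : ℕ, 2 ≤ n → ∀ b ∈ Bset n, wt n (sh n b) = wt n b)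
    (hc : 1 ≤ cc) (hM : ∀ L : ℕ, 2 ≤ L → 1 ≤ M L ∧ (L : ℝ) ≤ cc * M L) (hML : ∀ L : ℕ, 2 ≤ L → M L ≤ L)
    (h0 : ∀ n : ℕ, 2 ≤ n → ∀ b ∈ Bset n, ∀ v, |Gf n b v - gFree v| ≤ D 0 / (n : ℝ) ^ 2)
    (h1 : ∀ n : ℕ, 2 ≤ n → ∀ b ∈ Bset n, ∀ v (ρ : Fin 4),
      |(Gf n b (v + unitVec ρ) - gFree (v + unitVec ρ)) - (Gf n b v - gFree v)| ≤ D 1 / (n : ℝ) ^ 3)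
    (h1x : ∀ n : ℕ, 2 ≤ n → ∀ b ∈ Bset n, ∀ v, |Gf n (sh n b) v - Gf n b v| ≤ D 3 / (n : ℝ) ^ 3)
    (h2x : ∀ n : ℕ, 2 ≤ n → ∀ b ∈ Bset n, ∀ v,
      |(Gf n b (v + unitVec μ + unitVec ν) - gFree (v + unitVec μ + unitVec ν)) - (Gf n b (v + unitVec μ) - gFree (v + unitVec μ)) -
          ((Gf n (sh n b) (v + unitVec ν) - gFree (v + unitVec ν)) - (Gf n (sh n b) v - gFree v))| ≤ D 2 / (n : ℝ) ^ 4)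
    (d0 : ∀ n : ℕ, 2 ≤ n → ∀ b ∈ Bset n, ∀ v : Pt, v ≠ 0 → |Gf n b v| ≤ A 0 * Real.exp (-(δ / n) * supNorm v) / (supNorm v : ℝ) ^ 2)
    (d1 : ∀ n : ℕ, 2 ≤ n → ∀ b ∈ Bset n, ∀ v : Pt, v ≠ 0 → ∀ ρ : Fin 4,
      |Gf n b (v + unitVec ρ) - Gf n b v| ≤ A 1 * Real.exp (-(δ / n) * supNorm v) / (supNorm v : ℝ) ^ 3)
    (d1x : ∀ n : ℕ, 2 ≤ n → ∀ b ∈ Bset n, ∀ v : Pt, v ≠ 0 →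
      |Gf n (sh n b) v - Gf n b v| ≤ A 3 * Real.exp (-(δ / n) * supNorm v) / (supNorm v : ℝ) ^ 3)
    (d2x : ∀ n : ℕ, 2 ≤ n → ∀ b ∈ Bset n, ∀ v : Pt, v ≠ 0 →
      |Gf n b (v + unitVec μ + unitVec ν) - Gf n b (v + unitVec μ) - (Gf n (sh n b) (v + unitVec ν) - Gf n (sh n b) v)| ≤
        A 2 * Real.exp (-(δ / n) * supNorm v) / (supNorm v : ℝ) ^ 4)
    (hU : ∀ m : ℕ, 1 ≤ m → |composedCoeff μC m - ∑ b ∈ Bset (Lc ^ m), wt (Lc ^ m) b * fullSum (stK μ ν N (Gf (Lc ^ m) b))| ≤ U)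
    (hid : IdentityForm μC S.β0) {rr γ₀ : ℝ} (hrem : RemainderConst S γ₀ rr) :
    BetaAvgAFH (B12Normalization.stepBal N Lc - rr)
      (2 *
      (constA (|kappaBal N| * 24 + |kappaBal N| * 110592) (bubbleConst Finset.univ (bfCoeff N) (bfP hμν) (bfQ hμν))
          ((80 * (∑ i ∈ (Finset.univ : Finset AfIdx), |afCoeff N i| * (Rx' hμν A i * Sx' hμν A i)) * (1 + cc / δ) + (U + 1)) +
            80 * ∑ i ∈ (Finset.univ : Finset AfIdx), |afCoeff N i| *
              ((((afP hμν i).A + (afP hμν i).B) * Sx hμν D i + Rx hμν D i * ((afQ hμν i).A + (afQ hμν i).B) + Rx hμν D i * Sx hμν D i)))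
          cc (kappaBal N * transverseValue))) γ₀ β :=
  betaAvgAFH_of_driftRemainderConst S
    (oneLoopDrift_of_scalarBounds_avgFirst S hμν hN hL hD hA hδ hwt0 hwt1 hshB hwtsh hc hM hML h0 h1 h1x h2x d0 d1 d1x d2x hU hid)
    hrem

/-- **THE AVERAGE-FIRST SCALAR WALL, [III] SIDE, ALL PROFILES** — the [III]-side twin of an3's
`SquareTableAvgFirst.endpointExistence_of_scalarBounds_avgFirst` (THE THIRD OFFICIAL STATEMENT, average-first; RULING (R14-4)/(R14-6)): THE SAME
binders with the remainder clause STRICT (`rr < stepBal N Lc`) + the [III] run-side data (`HaltsOutside`, `CurriesHBeta`, `0 < β₀`, `L ≥ 2`, maximal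
`p`, `κ₀ ≥ 6`) ⟹ `EndpointExistence Cn ∧ ∃ γ₁ > 0, ∀ γ ≤ min γ₀ γ₁, ∀ runs in ]0,γ], ∀ p′ ≤ p, ∀ A₀ ≥ 0: sizes (2.28)/(2.31) ∧ HorizonFacts`
((2.6)–(2.9) + (2.46)), every `β₀ > 0`, one threshold.  EVERY β-binder uninstantiated for Bałaban's objects.
[cite: Balaban1987RG1, Thm 2 p.259 and Thm 3 p.264] [cite: Balaban1988Convergent, (2.5)–(2.9) pp.255–256, (2.28) p.259, (2.46) p.263] -/
theorem wallEND_of_scalarBounds_avgFirst_allProfiles {β : HBeta} {Cn : B12.Construction} (hgen : ForwardGenerated Cn β) (hhalt : HaltsOutside Cn β) (hcur : CurriesHBeta Cn β)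
    (S : B12Beta.OneLoopSplit β) (hμν : μ ≠ ν) {N : ℝ} (hN : N ≠ 0)
    {Lc : ℕ} (hL : 2 ≤ Lc) {μC : ℕ → ℕ → ℝ} {Bset : ℕ → Finset κB} {wt : ℕ → κB → ℝ} {sh : ℕ → Equiv.Perm κB}
    {Gf : ℕ → κB → Pt → ℝ} {D A : ℕ → ℝ} (hD : ∀ j, 0 ≤ D j) (hA : ∀ j, 0 ≤ A j) {δ U cc : ℝ} {M : ℕ → ℕ} (hδ : 0 < δ)
    (hwt0 : ∀ n : ℕ, 2 ≤ n → ∀ b ∈ Bset n, 0 ≤ wt n b) (hwt1 : ∀ n : ℕ, 2 ≤ n → ∑ b ∈ Bset n, wt n b = 1)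
    (hshB : ∀ n : ℕ, 2 ≤ n → ∀ b, sh n b ∈ Bset n ↔ b ∈ Bset n) (hwtsh : ∀ n : ℕ, 2 ≤ n → ∀ b ∈ Bset n, wt n (sh n b) = wt n b)
    (hc : 1 ≤ cc) (hM : ∀ L : ℕ, 2 ≤ L → 1 ≤ M L ∧ (L : ℝ) ≤ cc * M L) (hML : ∀ L : ℕ, 2 ≤ L → M L ≤ L)
    (h0 : ∀ n : ℕ, 2 ≤ n → ∀ b ∈ Bset n, ∀ v, |Gf n b v - gFree v| ≤ D 0 / (n : ℝ) ^ 2)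
    (h1 : ∀ n : ℕ, 2 ≤ n → ∀ b ∈ Bset n, ∀ v (ρ : Fin 4),
      |(Gf n b (v + unitVec ρ) - gFree (v + unitVec ρ)) - (Gf n b v - gFree v)| ≤ D 1 / (n : ℝ) ^ 3)
    (h1x : ∀ n : ℕ, 2 ≤ n → ∀ b ∈ Bset n, ∀ v, |Gf n (sh n b) v - Gf n b v| ≤ D 3 / (n : ℝ) ^ 3)
    (h2x : ∀ n : ℕ, 2 ≤ n → ∀ b ∈ Bset n, ∀ v,
      |(Gf n b (v + unitVec μ + unitVec ν) - gFree (v + unitVec μ + unitVec ν)) - (Gf n b (v + unitVec μ) - gFree (v + unitVec μ)) -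
          ((Gf n (sh n b) (v + unitVec ν) - gFree (v + unitVec ν)) - (Gf n (sh n b) v - gFree v))| ≤ D 2 / (n : ℝ) ^ 4)
    (d0 : ∀ n : ℕ, 2 ≤ n → ∀ b ∈ Bset n, ∀ v : Pt, v ≠ 0 → |Gf n b v| ≤ A 0 * Real.exp (-(δ / n) * supNorm v) / (supNorm v : ℝ) ^ 2)
    (d1 : ∀ n : ℕ, 2 ≤ n → ∀ b ∈ Bset n, ∀ v : Pt, v ≠ 0 → ∀ ρ : Fin 4,
      |Gf n b (v + unitVec ρ) - Gf n b v| ≤ A 1 * Real.exp (-(δ / n) * supNorm v) / (supNorm v : ℝ) ^ 3)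
    (d1x : ∀ n : ℕ, 2 ≤ n → ∀ b ∈ Bset n, ∀ v : Pt, v ≠ 0 →
      |Gf n (sh n b) v - Gf n b v| ≤ A 3 * Real.exp (-(δ / n) * supNorm v) / (supNorm v : ℝ) ^ 3)
    (d2x : ∀ n : ℕ, 2 ≤ n → ∀ b ∈ Bset n, ∀ v : Pt, v ≠ 0 →
      |Gf n b (v + unitVec μ + unitVec ν) - Gf n b (v + unitVec μ) - (Gf n (sh n b) (v + unitVec ν) - Gf n (sh n b) v)| ≤
        A 2 * Real.exp (-(δ / n) * supNorm v) / (supNorm v : ℝ) ^ 4)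
    (hU : ∀ m : ℕ, 1 ≤ m → |composedCoeff μC m - ∑ b ∈ Bset (Lc ^ m), wt (Lc ^ m) b * fullSum (stK μ ν N (Gf (Lc ^ m) b))| ≤ U)
    (hid : IdentityForm μC S.β0)
    {rr γ₀ β' β₀ : ℝ} (hγ₀ : 0 < γ₀) (hrem : RemainderConst S γ₀ rr) (hr : rr < B12Normalization.stepBal N Lc)
    (hcont : BetaContH γ₀ β) (hup : BetaUpperH β' γ₀ β) (hβ' : 0 ≤ β') (hβ₀ : 0 < β₀)
    {L : ℕ} (hL2 : 2 ≤ L) (p : ℕ) {κ₀ : ℕ} (hκ : 6 ≤ κ₀) :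
    EndpointExistence Cn ∧ ∃ γ₁ : ℝ, 0 < γ₁ ∧
      ∀ γ : ℝ, 0 < γ → γ ≤ min γ₀ γ₁ → ∀ Pr : B12.RunParams, (Cn Pr).flow.InInterval γ Pr.K →
        ∀ p' : ℕ, p' ≤ p → ∀ A₀ : ℝ, 0 ≤ A₀ →
          ∃ Rj : ℕ → ℕ, (∀ j, B14.IsRj L p' ((Cn Pr).flow.g j) (Rj j)) ∧
            HorizonFacts (Cn Pr).flow β' β₀ A₀ L p' κ₀ Rj Pr.K :=
  (betaAvgAFH_of_scalarBounds_avgFirst S hμν hN hL hD hA hδ hwt0 hwt1 hshB hwtsh hc hM hML h0 h1 h1x h2x d0 d1 d1x d2x hU hid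
      hrem).endpoint_and_flowControl_allProfiles (sub_pos.mpr hr) hgen hhalt hcur hγ₀ hβ' hβ₀ hL2 p hcont hup hκ

end AvgFirst

/-! ## §2 The same with finite-volume graded bounds (an4 `WallVolumeTransfer`) -/

section Volume

variable {ι : Type*} {l : Filter ι} [l.NeBot] {μ ν : Fin 4} {κB : Type*}

/-- **… WITH FINITE-VOLUME GRADED BOUNDS** — the [III]-side twin of an4's `WallVolumeTransfer.endpointExistence_of_scalarBounds_avgFirst_vol`
(RULING (R13-1)/(R14-5): the eight `ℤ⁴` rows replaced by torus-indexed families `GT n b t`, `gT n b t`, their pointwise volume limits `hG`/`hg`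
((ii-a)/(ii-b) = (D3-vol)) and the eight rows ON THE TORUS SIDE eventually in the volume); same deltas as §1. [cite: Balaban1988Convergent, (2.5)–(2.9) pp.255–256 and (2.46) p.263] -/
theorem wallEND_of_scalarBounds_avgFirst_vol_allProfiles {β : HBeta} {Cn : B12.Construction} (hgen : ForwardGenerated Cn β) (hhalt : HaltsOutside Cn β) (hcur : CurriesHBeta Cn β)
    (S : B12Beta.OneLoopSplit β) (hμν : μ ≠ ν) {N : ℝ} (hN : N ≠ 0)
    {Lc : ℕ} (hL : 2 ≤ Lc) {μC : ℕ → ℕ → ℝ} {Bset : ℕ → Finset κB} {wt : ℕ → κB → ℝ} {sh : ℕ → Equiv.Perm κB}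
    {GT gT : ℕ → κB → ι → Pt → ℝ} {Gf : ℕ → κB → Pt → ℝ} {D A : ℕ → ℝ}
    (hD : ∀ j, 0 ≤ D j) (hA : ∀ j, 0 ≤ A j) {δ U cc : ℝ} {M : ℕ → ℕ} (hδ : 0 < δ)
    (hwt0 : ∀ n : ℕ, 2 ≤ n → ∀ b ∈ Bset n, 0 ≤ wt n b) (hwt1 : ∀ n : ℕ, 2 ≤ n → ∑ b ∈ Bset n, wt n b = 1)
    (hshB : ∀ n : ℕ, 2 ≤ n → ∀ b, sh n b ∈ Bset n ↔ b ∈ Bset n) (hwtsh : ∀ n : ℕ, 2 ≤ n → ∀ b ∈ Bset n, wt n (sh n b) = wt n b)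
    (hc : 1 ≤ cc) (hM : ∀ L : ℕ, 2 ≤ L → 1 ≤ M L ∧ (L : ℝ) ≤ cc * M L) (hML : ∀ L : ℕ, 2 ≤ L → M L ≤ L)
    (hG : ∀ n : ℕ, 2 ≤ n → ∀ b ∈ Bset n, ∀ v, Tendsto (fun t => GT n b t v) l (𝓝 (Gf n b v)))
    (hg : ∀ n : ℕ, 2 ≤ n → ∀ b ∈ Bset n, ∀ v, Tendsto (fun t => gT n b t v) l (𝓝 (gFree v)))
    (h0T : ∀ n : ℕ, 2 ≤ n → ∀ b ∈ Bset n, ∀ v, ∀ᶠ t in l, |GT n b t v - gT n b t v| ≤ D 0 / (n : ℝ) ^ 2)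
    (h1T : ∀ n : ℕ, 2 ≤ n → ∀ b ∈ Bset n, ∀ v (ρ : Fin 4), ∀ᶠ t in l,
      |(GT n b t (v + unitVec ρ) - gT n b t (v + unitVec ρ)) - (GT n b t v - gT n b t v)| ≤ D 1 / (n : ℝ) ^ 3)
    (h1xT : ∀ n : ℕ, 2 ≤ n → ∀ b ∈ Bset n, ∀ v, ∀ᶠ t in l, |GT n (sh n b) t v - GT n b t v| ≤ D 3 / (n : ℝ) ^ 3)
    (h2xT : ∀ n : ℕ, 2 ≤ n → ∀ b ∈ Bset n, ∀ v, ∀ᶠ t in l,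
      |(GT n b t (v + unitVec μ + unitVec ν) - gT n b t (v + unitVec μ + unitVec ν)) -
          (GT n b t (v + unitVec μ) - gT n b t (v + unitVec μ)) -
          ((GT n (sh n b) t (v + unitVec ν) - gT n (sh n b) t (v + unitVec ν)) - (GT n (sh n b) t v - gT n (sh n b) t v))| ≤
        D 2 / (n : ℝ) ^ 4)
    (d0T : ∀ n : ℕ, 2 ≤ n → ∀ b ∈ Bset n, ∀ v : Pt, v ≠ 0 → ∀ᶠ t in l,
      |GT n b t v| ≤ A 0 * Real.exp (-(δ / n) * supNorm v) / (supNorm v : ℝ) ^ 2)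
    (d1T : ∀ n : ℕ, 2 ≤ n → ∀ b ∈ Bset n, ∀ v : Pt, v ≠ 0 → ∀ ρ : Fin 4, ∀ᶠ t in l,
      |GT n b t (v + unitVec ρ) - GT n b t v| ≤ A 1 * Real.exp (-(δ / n) * supNorm v) / (supNorm v : ℝ) ^ 3)
    (d1xT : ∀ n : ℕ, 2 ≤ n → ∀ b ∈ Bset n, ∀ v : Pt, v ≠ 0 → ∀ᶠ t in l,
      |GT n (sh n b) t v - GT n b t v| ≤ A 3 * Real.exp (-(δ / n) * supNorm v) / (supNorm v : ℝ) ^ 3)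
    (d2xT : ∀ n : ℕ, 2 ≤ n → ∀ b ∈ Bset n, ∀ v : Pt, v ≠ 0 → ∀ᶠ t in l,
      |GT n b t (v + unitVec μ + unitVec ν) - GT n b t (v + unitVec μ) - (GT n (sh n b) t (v + unitVec ν) - GT n (sh n b) t v)| ≤
        A 2 * Real.exp (-(δ / n) * supNorm v) / (supNorm v : ℝ) ^ 4)
    (hU : ∀ m : ℕ, 1 ≤ m → |composedCoeff μC m - ∑ b ∈ Bset (Lc ^ m), wt (Lc ^ m) b * fullSum (stK μ ν N (Gf (Lc ^ m) b))| ≤ U)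
    (hid : IdentityForm μC S.β0)
    {rr γ₀ β' β₀ : ℝ} (hγ₀ : 0 < γ₀) (hrem : RemainderConst S γ₀ rr) (hr : rr < B12Normalization.stepBal N Lc)
    (hcont : BetaContH γ₀ β) (hup : BetaUpperH β' γ₀ β) (hβ' : 0 ≤ β') (hβ₀ : 0 < β₀)
    {L : ℕ} (hL2 : 2 ≤ L) (p : ℕ) {κ₀ : ℕ} (hκ : 6 ≤ κ₀) :
    EndpointExistence Cn ∧ ∃ γ₁ : ℝ, 0 < γ₁ ∧
      ∀ γ : ℝ, 0 < γ → γ ≤ min γ₀ γ₁ → ∀ Pr : B12.RunParams, (Cn Pr).flow.InInterval γ Pr.K →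
        ∀ p' : ℕ, p' ≤ p → ∀ A₀ : ℝ, 0 ≤ A₀ →
          ∃ Rj : ℕ → ℕ, (∀ j, B14.IsRj L p' ((Cn Pr).flow.g j) (Rj j)) ∧
            HorizonFacts (Cn Pr).flow β' β₀ A₀ L p' κ₀ Rj Pr.K :=
  wallEND_of_scalarBounds_avgFirst_allProfiles hgen hhalt hcur S hμν hN hL hD hA hδ hwt0 hwt1 hshB hwtsh hc hM hML
    (h0_avg_vol hG hg h0T) (h1_avg_vol hG hg h1T) (h1x_vol hshB hG h1xT) (h2x_vol hshB hG hg h2xT) (d0_avg_vol hG d0T)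
    (d1_avg_vol hG d1T) (d1x_vol hshB hG d1xT) (d2x_vol hshB hG d2xT) hU hid hγ₀ hrem hr hcont hup hβ' hβ₀ hL2 p hκ

end Volume

/-! ## §3 The vector small-field legs at the volume seam (an1 `VectorTailsSeam`) on the [III] side -/

section VectorTails

/-- **THE VECTOR SMALL-FIELD LEGS AT THE VOLUME SEAM, [III] SIDE, ALL PROFILES — ANY INSTANCE** — the [III]-side twin of an1's
`VectorTailsSeam.endpointExistence_of_vectorTails_vol` (RULING (R16) ADDENDUM (c′), BETA-SPEC §7.32: the (D3) census movement).  THE SAME binders —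
(α) the PRINTED-WITH-PROOF U = 1 leaves BY NAME `h12 : B5.Prop12Printed …`, `h126 : B5.Kernel126_127Printed …` (never discharged here), `hgrow`,
the instance data and hypotheses (`X₀ kk nn φ hφ`, hX-mod/hk/hν/hshB), (D3-vol) `hG`/`hg`, (D3-Γ) the Γ-part rows `h0S/h1S/h1×S/h2×S`, the wall's
one-loop data (`hU` + `hid` = (D1) in two-binder form), (D4) `hrem` — with `hr : rr < stepBal N Lc` STRICT, (D5) `hcont`, `hup`, and the [III]
run-side data ⟹ `EndpointExistence Cn` ∧ the whole located [III] list (all profiles, every β₀, one threshold).  The section variables of an1's file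
(`τ κB Mv hMv a ha`) are explicit leading binders here.  [cite: Balaban1984PropagatorsI, Prop. 1.2 p.35 (1.110) and (1.126)–(1.127) p.38 — BY NAME, as binders]
[cite: Balaban1988Convergent, (2.5)–(2.9) pp.255–256 and (2.46) p.263] -/
theorem wallEND_of_vectorTails_vol_allProfiles
    {τ : Type} {κB : Type*} (Mv : ℕ+ × τ → Fin 4 → ℕ) [hMv : ∀ i ρ, NeZero (Mv i ρ)] (a : ℝ) (ha : 0 < a)
    (h12 : B5.Prop12Printed (fam (fun i : ℕ+ × τ => ((i.1 : ℕ+) : ℕ)) (fun i => i.1.pos) Mv a ha))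
    (h126 : B5.Kernel126_127Printed (kfam (fun i : ℕ+ × τ => ((i.1 : ℕ+) : ℕ)) Mv))
    {l : Filter τ} [l.NeBot]
    (hgrow : ∀ (m : ℕ+) (ρ : Fin 4), Tendsto (fun t => (m : ℕ) * Mv (m, t) ρ) l atTop)
    (X₀ : (i : ℕ+ × τ) → κB → Tor (fine ((i.1 : ℕ+) : ℕ) (Mv i))) (kk nn : ℕ → κB → Fin 4)
    (φ : ℂ →+ ℝ) (hφ : ∀ z, |φ z| ≤ ‖z‖) {Bset : ℕ → Finset κB} {sh : ℕ → Equiv.Perm κB}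
    {μ ν : Fin 4}
    (hX : ∀ (m : ℕ+) (t : τ), ∀ b ∈ Bset m,
      X₀ (m, t) (sh m b) - (X₀ (m, t) b + B5Prop11Plancherel.unitVec (fine (m : ℕ) (Mv (m, t))) μ)
        ∈ blockSteps (m : ℕ) (Mv (m, t)))
    (hk : ∀ m : ℕ, ∀ b ∈ Bset m, kk m (sh m b) = kk m b)
    (hν : ∀ m : ℕ, ∀ b ∈ Bset m, nn m (sh m b) = nn m b)
    (hshB : ∀ n : ℕ, 2 ≤ n → ∀ b, sh n b ∈ Bset n ↔ b ∈ Bset n)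
    {β : HBeta} {Cn : B12.Construction} (hgen : ForwardGenerated Cn β) (hhalt : HaltsOutside Cn β) (hcur : CurriesHBeta Cn β)
    (S : B12Beta.OneLoopSplit β) (hμν : μ ≠ ν) {N : ℝ} (hN : N ≠ 0)
    {Lc : ℕ} (hL : 2 ≤ Lc) {μC : ℕ → ℕ → ℝ} {wt : ℕ → κB → ℝ}
    {gT : ℕ → κB → τ → Pt → ℝ} {Gf : ℕ → κB → Pt → ℝ} {D : ℕ → ℝ} (hD : ∀ j, 0 ≤ D j)
    {U cc : ℝ} {M : ℕ → ℕ}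
    (hwt0 : ∀ n : ℕ, 2 ≤ n → ∀ b ∈ Bset n, 0 ≤ wt n b) (hwt1 : ∀ n : ℕ, 2 ≤ n → ∑ b ∈ Bset n, wt n b = 1)
    (hwtsh : ∀ n : ℕ, 2 ≤ n → ∀ b ∈ Bset n, wt n (sh n b) = wt n b)
    (hc : 1 ≤ cc) (hM : ∀ L : ℕ, 2 ≤ L → 1 ≤ M L ∧ (L : ℝ) ≤ cc * M L) (hML : ∀ L : ℕ, 2 ≤ L → M L ≤ L)
    (hG : ∀ n : ℕ, 2 ≤ n → ∀ b ∈ Bset n, ∀ v,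
      Tendsto (fun t => GT Mv a ha X₀ kk nn φ n b t v) l (𝓝 (Gf n b v)))
    (hg : ∀ n : ℕ, 2 ≤ n → ∀ b ∈ Bset n, ∀ v, Tendsto (fun t => gT n b t v) l (𝓝 (gFree v)))
    (h0S : ∀ n : ℕ, 2 ≤ n → ∀ b ∈ Bset n, ∀ v, ∀ᶠ t in l,
      |GS Mv a X₀ kk nn φ n b t v - gT n b t v| ≤ D 0 / (n : ℝ) ^ 2)
    (h1S : ∀ n : ℕ, 2 ≤ n → ∀ b ∈ Bset n, ∀ v (ρ : Fin 4), ∀ᶠ t in l,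
      |(GS Mv a X₀ kk nn φ n b t (v + unitVec ρ) - gT n b t (v + unitVec ρ))
          - (GS Mv a X₀ kk nn φ n b t v - gT n b t v)| ≤ D 1 / (n : ℝ) ^ 3)
    (h1xS : ∀ n : ℕ, 2 ≤ n → ∀ b ∈ Bset n, ∀ v, ∀ᶠ t in l,
      |GS Mv a X₀ kk nn φ n (sh n b) t v - GS Mv a X₀ kk nn φ n b t v| ≤ D 3 / (n : ℝ) ^ 3)
    (h2xS : ∀ n : ℕ, 2 ≤ n → ∀ b ∈ Bset n, ∀ v, ∀ᶠ t in l,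
      |(GS Mv a X₀ kk nn φ n b t (v + unitVec μ + unitVec ν) - gT n b t (v + unitVec μ + unitVec ν))
          - (GS Mv a X₀ kk nn φ n b t (v + unitVec μ) - gT n b t (v + unitVec μ))
          - ((GS Mv a X₀ kk nn φ n (sh n b) t (v + unitVec ν) - gT n (sh n b) t (v + unitVec ν))
            - (GS Mv a X₀ kk nn φ n (sh n b) t v - gT n (sh n b) t v))| ≤ D 2 / (n : ℝ) ^ 4)
    (hU : ∀ m : ℕ, 1 ≤ m →
      |composedCoeff μC m - ∑ b ∈ Bset (Lc ^ m), wt (Lc ^ m) b * fullSum (stK μ ν N (Gf (Lc ^ m) b))| ≤ U)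
    (hid : IdentityForm μC S.β0)
    {rr γ₀ β' β₀ : ℝ} (hγ₀ : 0 < γ₀) (hrem : RemainderConst S γ₀ rr) (hr : rr < B12Normalization.stepBal N Lc)
    (hcont : BetaContH γ₀ β) (hup : BetaUpperH β' γ₀ β) (hβ' : 0 ≤ β') (hβ₀ : 0 < β₀)
    {L : ℕ} (hL2 : 2 ≤ L) (p : ℕ) {κ₀ : ℕ} (hκ : 6 ≤ κ₀) :
    EndpointExistence Cn ∧ ∃ γ₁ : ℝ, 0 < γ₁ ∧
      ∀ γ : ℝ, 0 < γ → γ ≤ min γ₀ γ₁ → ∀ Pr : B12.RunParams, (Cn Pr).flow.InInterval γ Pr.K →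
        ∀ p' : ℕ, p' ≤ p → ∀ A₀ : ℝ, 0 ≤ A₀ →
          ∃ Rj : ℕ → ℕ, (∀ j, B14.IsRj L p' ((Cn Pr).flow.g j) (Rj j)) ∧
            HorizonFacts (Cn Pr).flow β' β₀ A₀ L p' κ₀ Rj Pr.K := by
  obtain ⟨δ, A, hδ, hA, d0T, d1T, d1xT, d2xT⟩ :=
    wall_rows_mod Mv a ha h12 h126 hgrow X₀ kk nn φ hφ Bset sh (μ := μ) (ν := ν) hX hk hν
  obtain ⟨H0, H1, H1x, H2x⟩ := hRows_of_gamma Mv a ha X₀ kk nn hφ Bset sh hX hk hν gT D h0S h1S h1xS h2xS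
  exact wallEND_of_scalarBounds_avgFirst_vol_allProfiles hgen hhalt hcur S hμν hN hL (Dvec_nonneg hD ha) hA hδ hwt0 hwt1 hshB
    hwtsh hc hM hML hG hg H0 H1 H1x H2x d0T d1T d1xT d2xT hU hid hγ₀ hrem hr hcont hup hβ' hβ₀ hL2 p hκ

/-- **… ON THE LABELLED CYCLIC BLOCK INSTANCE** — twin of an1's `VectorTailsSeam.endpointExistence_of_vectorTails_block` (instance hypotheses
hX-mod/hk/hν/hshB discharged by `VectorTailsBlock`; label type renamed `L ↦ Λ` because the [III] side uses `L` for [III]'s block-size parameter).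
[cite: Balaban1988Convergent, (2.5)–(2.9) pp.255–256 and (2.46) p.263] -/
theorem wallEND_of_vectorTails_block_allProfiles
    {τ : Type} {Λ : Type*} (Mv : ℕ+ × τ → Fin 4 → ℕ) [hMv : ∀ i ρ, NeZero (Mv i ρ)] (a : ℝ) (ha : 0 < a)
    (h12 : B5.Prop12Printed (fam (fun i : ℕ+ × τ => ((i.1 : ℕ+) : ℕ)) (fun i => i.1.pos) Mv a ha))
    (h126 : B5.Kernel126_127Printed (kfam (fun i : ℕ+ × τ => ((i.1 : ℕ+) : ℕ)) Mv))
    {l : Filter τ} [l.NeBot]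
    (hgrow : ∀ (m : ℕ+) (ρ : Fin 4), Tendsto (fun t => (m : ℕ) * Mv (m, t) ρ) l atTop)
    (SL : Finset Λ) (k ν₀ : Λ → Fin 4) (φ : ℂ →+ ℝ) (hφ : ∀ z, |φ z| ≤ ‖z‖) {μ ν : Fin 4}
    {β : HBeta} {Cn : B12.Construction} (hgen : ForwardGenerated Cn β) (hhalt : HaltsOutside Cn β) (hcur : CurriesHBeta Cn β)
    (S : B12Beta.OneLoopSplit β) (hμν : μ ≠ ν) {N : ℝ} (hN : N ≠ 0)
    {Lc : ℕ} (hL : 2 ≤ Lc) {μC : ℕ → ℕ → ℝ} {wt : ℕ → Pt × Λ → ℝ}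
    {gT : ℕ → Pt × Λ → τ → Pt → ℝ} {Gf : ℕ → Pt × Λ → Pt → ℝ} {D : ℕ → ℝ} (hD : ∀ j, 0 ≤ D j)
    {U cc : ℝ} {M : ℕ → ℕ}
    (hwt0 : ∀ n : ℕ, 2 ≤ n → ∀ b ∈ lblock SL n, 0 ≤ wt n b)
    (hwt1 : ∀ n : ℕ, 2 ≤ n → ∑ b ∈ lblock SL n, wt n b = 1)
    (hwtsh : ∀ n : ℕ, 2 ≤ n → ∀ b ∈ lblock SL n, wt n (lshift n μ b) = wt n b)
    (hc : 1 ≤ cc) (hM : ∀ L : ℕ, 2 ≤ L → 1 ≤ M L ∧ (L : ℝ) ≤ cc * M L) (hML : ∀ L : ℕ, 2 ≤ L → M L ≤ L)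
    (hG : ∀ n : ℕ, 2 ≤ n → ∀ b ∈ lblock SL n, ∀ v,
      Tendsto (fun t => GT Mv a ha (X₀L Mv) (fun _ b => k b.2) (fun _ b => ν₀ b.2) φ n b t v) l
        (𝓝 (Gf n b v)))
    (hg : ∀ n : ℕ, 2 ≤ n → ∀ b ∈ lblock SL n, ∀ v, Tendsto (fun t => gT n b t v) l (𝓝 (gFree v)))
    (h0S : ∀ n : ℕ, 2 ≤ n → ∀ b ∈ lblock SL n, ∀ v, ∀ᶠ t in l,
      |GS Mv a (X₀L Mv) (fun _ b => k b.2) (fun _ b => ν₀ b.2) φ n b t v - gT n b t v| ≤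
        D 0 / (n : ℝ) ^ 2)
    (h1S : ∀ n : ℕ, 2 ≤ n → ∀ b ∈ lblock SL n, ∀ v (ρ : Fin 4), ∀ᶠ t in l,
      |(GS Mv a (X₀L Mv) (fun _ b => k b.2) (fun _ b => ν₀ b.2) φ n b t (v + unitVec ρ)
            - gT n b t (v + unitVec ρ))
          - (GS Mv a (X₀L Mv) (fun _ b => k b.2) (fun _ b => ν₀ b.2) φ n b t v - gT n b t v)| ≤
        D 1 / (n : ℝ) ^ 3)
    (h1xS : ∀ n : ℕ, 2 ≤ n → ∀ b ∈ lblock SL n, ∀ v, ∀ᶠ t in l,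
      |GS Mv a (X₀L Mv) (fun _ b => k b.2) (fun _ b => ν₀ b.2) φ n (lshift n μ b) t v
          - GS Mv a (X₀L Mv) (fun _ b => k b.2) (fun _ b => ν₀ b.2) φ n b t v| ≤ D 3 / (n : ℝ) ^ 3)
    (h2xS : ∀ n : ℕ, 2 ≤ n → ∀ b ∈ lblock SL n, ∀ v, ∀ᶠ t in l,
      |(GS Mv a (X₀L Mv) (fun _ b => k b.2) (fun _ b => ν₀ b.2) φ n b t (v + unitVec μ + unitVec ν)
            - gT n b t (v + unitVec μ + unitVec ν))
          - (GS Mv a (X₀L Mv) (fun _ b => k b.2) (fun _ b => ν₀ b.2) φ n b t (v + unitVec μ)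
            - gT n b t (v + unitVec μ))
          - ((GS Mv a (X₀L Mv) (fun _ b => k b.2) (fun _ b => ν₀ b.2) φ n (lshift n μ b) t
                (v + unitVec ν) - gT n (lshift n μ b) t (v + unitVec ν))
            - (GS Mv a (X₀L Mv) (fun _ b => k b.2) (fun _ b => ν₀ b.2) φ n (lshift n μ b) t v
              - gT n (lshift n μ b) t v))| ≤ D 2 / (n : ℝ) ^ 4)
    (hU : ∀ m : ℕ, 1 ≤ m →
      |composedCoeff μC m -
          ∑ b ∈ lblock SL (Lc ^ m), wt (Lc ^ m) b * fullSum (stK μ ν N (Gf (Lc ^ m) b))| ≤ U)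
    (hid : IdentityForm μC S.β0)
    {rr γ₀ β' β₀ : ℝ} (hγ₀ : 0 < γ₀) (hrem : RemainderConst S γ₀ rr) (hr : rr < B12Normalization.stepBal N Lc)
    (hcont : BetaContH γ₀ β) (hup : BetaUpperH β' γ₀ β) (hβ' : 0 ≤ β') (hβ₀ : 0 < β₀)
    {L : ℕ} (hL2 : 2 ≤ L) (p : ℕ) {κ₀ : ℕ} (hκ : 6 ≤ κ₀) :
    EndpointExistence Cn ∧ ∃ γ₁ : ℝ, 0 < γ₁ ∧
      ∀ γ : ℝ, 0 < γ → γ ≤ min γ₀ γ₁ → ∀ Pr : B12.RunParams, (Cn Pr).flow.InInterval γ Pr.K →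
        ∀ p' : ℕ, p' ≤ p → ∀ A₀ : ℝ, 0 ≤ A₀ →
          ∃ Rj : ℕ → ℕ, (∀ j, B14.IsRj L p' ((Cn Pr).flow.g j) (Rj j)) ∧
            HorizonFacts (Cn Pr).flow β' β₀ A₀ L p' κ₀ Rj Pr.K :=
  wallEND_of_vectorTails_vol_allProfiles Mv a ha h12 h126 hgrow (X₀L Mv) (fun _ b => k b.2) (fun _ b => ν₀ b.2) φ hφ
    (Bset := lblock SL) (sh := fun n => lshift n μ) (lwrapped_hX Mv SL μ) (fun _ _ _ => rfl) (fun _ _ _ => rfl)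
    (fun n _ b => lshift_mem_lblock_iff SL n μ b) hgen hhalt hcur S hμν hN hL hD hwt0 hwt1 hwtsh hc hM hML hG hg h0S h1S h1xS
    h2xS hU hid hγ₀ hrem hr hcont hup hβ' hβ₀ hL2 p hκ

/-- **… WITH UNIFORM WEIGHTS ON THE LABELLED BLOCK** — twin of an1's `VectorTailsSeam.endpointExistence_of_vectorTails_uniformBlock` (the lead's
binder check, BETA-SPEC §7.32 (c′): what remains = (α) `h12 h126` by name, `hgrow`, (D3-vol) `hG hg`, (D3-Γ) `h0S h1S h1×S h2×S`, (D1) `hU`+`hid`,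
(D4) `hrem hr`, (D5) `hcont`, `hup`, structural) — now with the [III] list as conclusion.  Label type `L ↦ Λ`.
[cite: Balaban1987RG1, Thm 2 p.259 and Thm 3 p.264] [cite: Balaban1988Convergent, (2.5)–(2.9) pp.255–256, (2.28) p.259, (2.46) p.263] -/
theorem wallEND_of_vectorTails_uniformBlock_allProfiles
    {Λ : Type*} {τ : Type} (Mv : ℕ+ × τ → Fin 4 → ℕ) [hMv : ∀ i ρ, NeZero (Mv i ρ)] (a : ℝ) (ha : 0 < a)
    (h12 : B5.Prop12Printed (fam (fun i : ℕ+ × τ => ((i.1 : ℕ+) : ℕ)) (fun i => i.1.pos) Mv a ha))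
    (h126 : B5.Kernel126_127Printed (kfam (fun i : ℕ+ × τ => ((i.1 : ℕ+) : ℕ)) Mv))
    {l : Filter τ} [l.NeBot]
    (hgrow : ∀ (m : ℕ+) (ρ : Fin 4), Tendsto (fun t => (m : ℕ) * Mv (m, t) ρ) l atTop)
    {SL : Finset Λ} (hSL : SL.Nonempty) (k ν₀ : Λ → Fin 4) (φ : ℂ →+ ℝ) (hφ : ∀ z, |φ z| ≤ ‖z‖)
    {μ ν : Fin 4}
    {β : HBeta} {Cn : B12.Construction} (hgen : ForwardGenerated Cn β) (hhalt : HaltsOutside Cn β) (hcur : CurriesHBeta Cn β)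
    (S : B12Beta.OneLoopSplit β) (hμν : μ ≠ ν) {N : ℝ} (hN : N ≠ 0)
    {Lc : ℕ} (hL : 2 ≤ Lc) {μC : ℕ → ℕ → ℝ}
    {gT : ℕ → Pt × Λ → τ → Pt → ℝ} {Gf : ℕ → Pt × Λ → Pt → ℝ} {D : ℕ → ℝ} (hD : ∀ j, 0 ≤ D j)
    {U cc : ℝ} {M : ℕ → ℕ}
    (hc : 1 ≤ cc) (hM : ∀ L : ℕ, 2 ≤ L → 1 ≤ M L ∧ (L : ℝ) ≤ cc * M L) (hML : ∀ L : ℕ, 2 ≤ L → M L ≤ L)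
    (hG : ∀ n : ℕ, 2 ≤ n → ∀ b ∈ lblock SL n, ∀ v,
      Tendsto (fun t => GT Mv a ha (X₀L Mv) (fun _ b => k b.2) (fun _ b => ν₀ b.2) φ n b t v) l
        (𝓝 (Gf n b v)))
    (hg : ∀ n : ℕ, 2 ≤ n → ∀ b ∈ lblock SL n, ∀ v, Tendsto (fun t => gT n b t v) l (𝓝 (gFree v)))
    (h0S : ∀ n : ℕ, 2 ≤ n → ∀ b ∈ lblock SL n, ∀ v, ∀ᶠ t in l,
      |GS Mv a (X₀L Mv) (fun _ b => k b.2) (fun _ b => ν₀ b.2) φ n b t v - gT n b t v| ≤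
        D 0 / (n : ℝ) ^ 2)
    (h1S : ∀ n : ℕ, 2 ≤ n → ∀ b ∈ lblock SL n, ∀ v (ρ : Fin 4), ∀ᶠ t in l,
      |(GS Mv a (X₀L Mv) (fun _ b => k b.2) (fun _ b => ν₀ b.2) φ n b t (v + unitVec ρ)
            - gT n b t (v + unitVec ρ))
          - (GS Mv a (X₀L Mv) (fun _ b => k b.2) (fun _ b => ν₀ b.2) φ n b t v - gT n b t v)| ≤
        D 1 / (n : ℝ) ^ 3)
    (h1xS : ∀ n : ℕ, 2 ≤ n → ∀ b ∈ lblock SL n, ∀ v, ∀ᶠ t in l,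
      |GS Mv a (X₀L Mv) (fun _ b => k b.2) (fun _ b => ν₀ b.2) φ n (lshift n μ b) t v
          - GS Mv a (X₀L Mv) (fun _ b => k b.2) (fun _ b => ν₀ b.2) φ n b t v| ≤ D 3 / (n : ℝ) ^ 3)
    (h2xS : ∀ n : ℕ, 2 ≤ n → ∀ b ∈ lblock SL n, ∀ v, ∀ᶠ t in l,
      |(GS Mv a (X₀L Mv) (fun _ b => k b.2) (fun _ b => ν₀ b.2) φ n b t (v + unitVec μ + unitVec ν)
            - gT n b t (v + unitVec μ + unitVec ν))
          - (GS Mv a (X₀L Mv) (fun _ b => k b.2) (fun _ b => ν₀ b.2) φ n b t (v + unitVec μ)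
            - gT n b t (v + unitVec μ))
          - ((GS Mv a (X₀L Mv) (fun _ b => k b.2) (fun _ b => ν₀ b.2) φ n (lshift n μ b) t
                (v + unitVec ν) - gT n (lshift n μ b) t (v + unitVec ν))
            - (GS Mv a (X₀L Mv) (fun _ b => k b.2) (fun _ b => ν₀ b.2) φ n (lshift n μ b) t v
              - gT n (lshift n μ b) t v))| ≤ D 2 / (n : ℝ) ^ 4)
    (hU : ∀ m : ℕ, 1 ≤ m →
      |composedCoeff μC m -
          ∑ b ∈ lblock SL (Lc ^ m), uwt SL (Lc ^ m) b * fullSum (stK μ ν N (Gf (Lc ^ m) b))| ≤ U)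
    (hid : IdentityForm μC S.β0)
    {rr γ₀ β' β₀ : ℝ} (hγ₀ : 0 < γ₀) (hrem : RemainderConst S γ₀ rr) (hr : rr < B12Normalization.stepBal N Lc)
    (hcont : BetaContH γ₀ β) (hup : BetaUpperH β' γ₀ β) (hβ' : 0 ≤ β') (hβ₀ : 0 < β₀)
    {L : ℕ} (hL2 : 2 ≤ L) (p : ℕ) {κ₀ : ℕ} (hκ : 6 ≤ κ₀) :
    EndpointExistence Cn ∧ ∃ γ₁ : ℝ, 0 < γ₁ ∧
      ∀ γ : ℝ, 0 < γ → γ ≤ min γ₀ γ₁ → ∀ Pr : B12.RunParams, (Cn Pr).flow.InInterval γ Pr.K →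
        ∀ p' : ℕ, p' ≤ p → ∀ A₀ : ℝ, 0 ≤ A₀ →
          ∃ Rj : ℕ → ℕ, (∀ j, B14.IsRj L p' ((Cn Pr).flow.g j) (Rj j)) ∧
            HorizonFacts (Cn Pr).flow β' β₀ A₀ L p' κ₀ Rj Pr.K :=
  wallEND_of_vectorTails_block_allProfiles Mv a ha h12 h126 hgrow SL k ν₀ φ hφ hgen hhalt hcur S hμν hN hL hD (wt := uwt SL)
    (fun n _ b _ => uwt_nonneg SL n b) (fun n hn => sum_uwt hSL n (by omega)) (fun n _ b _ => uwt_shift SL n μ b) hc hM hML hG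
    hg h0S h1S h1xS h2xS hU hid hγ₀ hrem hr hcont hup hβ' hβ₀ hL2 p hκ

end VectorTails

/-! ## §4 (v1.1) The even cubic volume instance (an5 `VectorLegVolumeAdapter`) on the [III] side -/

section EvenVolume

open Literature.MathematicalPhysics.QuantumFieldTheory.Balaban1983to89.Beta.VectorLegVolumeAdapter
  (MvE hgrowE DE_nonneg GfE hG_E hg_E h0S_E h1S_E h1xS_E h2xS_E)
open Literature.MathematicalPhysics.QuantumFieldTheory.Balaban1983to89.Beta.VectorTailsPt (abs_re_le)

/-- **THE VECTOR LEGS IN THE EVEN CUBIC VOLUME, [III] SIDE, ALL PROFILES** — the [III]-side twin of an5's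
`VectorLegVolumeAdapter.endpointExistence_of_vectorTails_evenVolume` (beta-ref v42 ADVISORY A-R313; BETA-SPEC §7.33): §3's uniform-block twin for the
family `MvE (n,t) = cubic 4 (2(t+1))`, real reading, diagonal components `k`, with an5's SIX instance binders discharged BY NAME exactly as in an5's
file (`hgrow := hgrowE`, `hg := hg_E` (comparison leg `gE`), `hG := hG_E` (explicit limit `GfE`), `h0S … h2xS := h0S_E … h2xS_E`, constants `DE`,
`hD := DE_nonneg`).  WHAT REMAINS A BINDER, exactly (an5's list + the [III] run-side data): the printed Props `h12`/`h126` BY NAME for this family,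
the structural / [III] run-side `hgen hhalt hcur` (WALL §4; NOT one-loop data — v1.3 docfix, XREAD C-lit3g16-1 I1), the wall's one-loop data (`S`,
`hμν`, `hN`, `hL`, `hc/hM/hML`, `hU` — about the explicit `GfE` —, `hid`), (D4) `hrem` with
`hr : rr < stepBal N Lc` STRICT, (D5) `hcont`, `hup`, `0 ≤ β′`, `0 < β₀`, `L ≥ 2`, `p`, `κ₀ ≥ 6` ⟹ `EndpointExistence Cn` ∧ the whole located
[III] list.  Label type renamed `L ↦ Λ`.  «END statement modulo {named binders}»; NOT `BetaPertH`, NOT continuum, NOT Clay.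
[cite: Balaban1987RG1, Thm 2 p.259 and Thm 3 p.264] [cite: Balaban1988Convergent, (2.5)–(2.9) pp.255–256, (2.28) p.259, (2.46) p.263] -/
theorem wallEND_of_vectorTails_evenVolume_allProfiles
    {Λ : Type*} (a : ℝ) (ha : 0 < a)
    (h12 : B5.Prop12Printed (fam (fun i : ℕ+ × ℕ => ((i.1 : ℕ+) : ℕ)) (fun i => i.1.pos) MvE a ha))
    (h126 : B5.Kernel126_127Printed (kfam (fun i : ℕ+ × ℕ => ((i.1 : ℕ+) : ℕ)) MvE))
    {SL : Finset Λ} (hSL : SL.Nonempty) (k : Λ → Fin 4)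
    {μ ν : Fin 4}
    {β : HBeta} {Cn : B12.Construction} (hgen : ForwardGenerated Cn β) (hhalt : HaltsOutside Cn β) (hcur : CurriesHBeta Cn β)
    (S : B12Beta.OneLoopSplit β) (hμν : μ ≠ ν) {N : ℝ} (hN : N ≠ 0)
    {Lc : ℕ} (hL : 2 ≤ Lc) {μC : ℕ → ℕ → ℝ}
    {U cc : ℝ} {M : ℕ → ℕ}
    (hc : 1 ≤ cc) (hM : ∀ L : ℕ, 2 ≤ L → 1 ≤ M L ∧ (L : ℝ) ≤ cc * M L) (hML : ∀ L : ℕ, 2 ≤ L → M L ≤ L)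
    (hU : ∀ m : ℕ, 1 ≤ m →
      |composedCoeff μC m -
          ∑ b ∈ lblock SL (Lc ^ m), uwt SL (Lc ^ m) b * fullSum (stK μ ν N (GfE a k (Lc ^ m) b))| ≤ U)
    (hid : IdentityForm μC S.β0)
    {rr γ₀ β' β₀ : ℝ} (hγ₀ : 0 < γ₀) (hrem : RemainderConst S γ₀ rr) (hr : rr < B12Normalization.stepBal N Lc)
    (hcont : BetaContH γ₀ β) (hup : BetaUpperH β' γ₀ β) (hβ' : 0 ≤ β') (hβ₀ : 0 < β₀)
    {L : ℕ} (hL2 : 2 ≤ L) (p : ℕ) {κ₀ : ℕ} (hκ : 6 ≤ κ₀) :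
    EndpointExistence Cn ∧ ∃ γ₁ : ℝ, 0 < γ₁ ∧
      ∀ γ : ℝ, 0 < γ → γ ≤ min γ₀ γ₁ → ∀ Pr : B12.RunParams, (Cn Pr).flow.InInterval γ Pr.K →
        ∀ p' : ℕ, p' ≤ p → ∀ A₀ : ℝ, 0 ≤ A₀ →
          ∃ Rj : ℕ → ℕ, (∀ j, B14.IsRj L p' ((Cn Pr).flow.g j) (Rj j)) ∧
            HorizonFacts (Cn Pr).flow β' β₀ A₀ L p' κ₀ Rj Pr.K :=
  wallEND_of_vectorTails_uniformBlock_allProfiles MvE a ha h12 h126 (l := atTop) hgrowE hSL k k Complex.reAddGroupHom abs_re_le hgen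
    hhalt hcur S hμν hN hL DE_nonneg hc hM hML (hG_E a ha SL k) (hg_E a ha SL) (h0S_E a ha SL k) (h1S_E a ha SL k) (h1xS_E a ha SL k μ)
    (h2xS_E a ha SL k μ ν) hU hid hγ₀ hrem hr hcont hup hβ' hβ₀ hL2 p hκ

end EvenVolume

/-! ## §5 (v1.2) THE SCALAR WALL's BASE END FORMS ON THE [III] SIDE (an3 `SquareTable` §EndToEnd / §scalar bounds; an5 `WallVolumeTransfer` §EndToEnd)

The third official statement's HEADLINE road-(1) END theorems — the realised table `(univ, bfCoeff N, bfP, bfQ)` with (W1)₀ discharged, the scalar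
ghost-leg bounds at one base point and base-point-averaged — and an5's two infinite-volume transfers of them had no [III] twin by name (BETA-SPEC §5.21
(d) over-claimed; census §5.21 (h)).  Binder blocks COPIED FROM THE TREE (generator staged as `HOME/b2b-balaban-strat-b14/g15/make_vectortails_v12.py`) with the [III] deltas; proofs =
the tree's own terms with the END socket swapped: the drift × constant-remainder socket of `AveragedAFCarrierScalewise` §3, INLINED as its one line
`(betaAvgAFH_of_driftRemainderConst S <an3's drift theorem> hrem).endpoint_and_flowControl_allProfiles (sub_pos.mpr hr) …` so that this leaf's import
closure is unchanged; the two volume forms are one application of the base-point forms with an5's `h0_vol … d2_vol` / `h0_avg_vol … d2_avg_vol`. -/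

section ScalarBase

open Literature.Probability.LatticeModels (annulus)
open Literature.MathematicalPhysics.QuantumFieldTheory.Balaban1983to89.Beta.DyadicShell (toReal)
open Literature.MathematicalPhysics.QuantumFieldTheory.Balaban1983to89.Beta.SquareTable
  (BfIdx oneLoopDrift_of_realisedTable oneLoopDrift_of_scalarBounds oneLoopDrift_of_scalarBounds_avg)
open Literature.MathematicalPhysics.QuantumFieldTheory.Balaban1983to89.Beta.WallVolumeTransfer
  (h0_vol h1_vol h2_vol d0_vol d1_vol d2_vol h2_avg_vol d2_avg_vol)

variable {ι : Type*} {l : Filter ι} [l.NeBot] {μ ν : Fin 4} {κB : Type*}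

/-- [III] twin of an3's `SquareTable.endpointExistence_of_realisedTable` — the (R11)/(R10-1′) wall for the REALISED table `(univ, bfCoeff N, bfP, bfQ)`
((W1)₀ discharged by an3), one base point. [cite: Balaban1987RG1, Thm 2 p.259 and Thm 3 p.264]
[cite: Balaban1988Convergent, (2.5)–(2.9) pp.255–256, (2.28) p.259, (2.46) p.263] -/
theorem wallEND_of_realisedTable_allProfiles {β : HBeta} {Cn : B12.Construction} (hgen : ForwardGenerated Cn β)
    (hhalt : HaltsOutside Cn β) (hcur : CurriesHBeta Cn β)
    (S : B12Beta.OneLoopSplit β) {μ ν : Fin 4} (hμν : μ ≠ ν) {N : ℝ} (hN : N ≠ 0)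
    {Lc : ℕ} (hL : 2 ≤ Lc) {μC : ℕ → ℕ → ℝ}
    {F' G' : BfIdx → ℕ → Pt → ℝ} {R S' R' Sg : BfIdx → ℝ} {δ U cc : ℝ} {M : ℕ → ℕ}
    (hR : ∀ i ∈ (Finset.univ : Finset BfIdx), 0 ≤ R i) (hS : ∀ i ∈ (Finset.univ : Finset BfIdx), 0 ≤ Sg i)
    (hR' : ∀ i ∈ (Finset.univ : Finset BfIdx), 0 ≤ R' i) (hS' : ∀ i ∈ (Finset.univ : Finset BfIdx), 0 ≤ S' i)
    (hδ : 0 < δ)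
    (hc : 1 ≤ cc) (hM : ∀ L : ℕ, 2 ≤ L → 1 ≤ M L ∧ (L : ℝ) ≤ cc * M L) (hML : ∀ L : ℕ, 2 ≤ L → M L ≤ L)
    (hF : ∀ m : ℕ, 1 ≤ m → ∀ w ∈ annulus 4 0 (M (Lc ^ m)), ∀ i ∈ (Finset.univ : Finset BfIdx),
      |F' i (Lc ^ m) w - (bfP hμν i).f (Lc ^ m) 0 w| ≤ R i / ((supNorm w : ℝ) ^ ((bfP hμν i).a - 2) * ((Lc ^ m : ℕ) : ℝ) ^ 2))
    (hG : ∀ m : ℕ, 1 ≤ m → ∀ w ∈ annulus 4 0 (M (Lc ^ m)), ∀ i ∈ (Finset.univ : Finset BfIdx),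
      |G' i (Lc ^ m) w - (bfQ hμν i).f (Lc ^ m) 0 w| ≤ Sg i / ((supNorm w : ℝ) ^ ((bfQ hμν i).a - 2) * ((Lc ^ m : ℕ) : ℝ) ^ 2))
    (hFtail : ∀ m : ℕ, 1 ≤ m → ∀ r : ℕ, M (Lc ^ m) ≤ r → ∀ w ∈ annulus 4 r (r + 1), ∀ i ∈ (Finset.univ : Finset BfIdx),
      |F' i (Lc ^ m) w| ≤ R' i / ((r : ℝ) + 1) ^ (bfP hμν i).a * Real.exp (-(δ / ((Lc ^ m : ℕ) : ℝ)) * ((r : ℝ) + 1)))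
    (hGtail : ∀ m : ℕ, 1 ≤ m → ∀ r : ℕ, M (Lc ^ m) ≤ r → ∀ w ∈ annulus 4 r (r + 1), ∀ i ∈ (Finset.univ : Finset BfIdx),
      |G' i (Lc ^ m) w| ≤ S' i / ((r : ℝ) + 1) ^ (bfQ hμν i).a)
    (hident : ∀ m : ℕ, 1 ≤ m → ∃ R₀ : ℕ, M (Lc ^ m) ≤ R₀ ∧
      |composedCoeff μC m - ∑ w ∈ annulus 4 0 R₀, toReal w μ * toReal w ν *
        ∑ i ∈ (Finset.univ : Finset BfIdx), bfCoeff N i * (F' i (Lc ^ m) w * G' i (Lc ^ m) w)| ≤ U)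
    (hid : IdentityForm μC S.β0)
    {rr γ₀ β' β₀ : ℝ} (hγ₀ : 0 < γ₀) (hrem : RemainderConst S γ₀ rr) (hr : rr < B12Normalization.stepBal N Lc)
    (hcont : BetaContH γ₀ β) (hup : BetaUpperH β' γ₀ β) (hβ' : 0 ≤ β') (hβ₀ : 0 < β₀)
    {L : ℕ} (hL2 : 2 ≤ L) (p : ℕ) {κ₀ : ℕ} (hκ : 6 ≤ κ₀) :
    EndpointExistence Cn ∧ ∃ γ₁ : ℝ, 0 < γ₁ ∧
      ∀ γ : ℝ, 0 < γ → γ ≤ min γ₀ γ₁ → ∀ Pr : B12.RunParams, (Cn Pr).flow.InInterval γ Pr.K →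
        ∀ p' : ℕ, p' ≤ p → ∀ A₀ : ℝ, 0 ≤ A₀ →
          ∃ Rj : ℕ → ℕ, (∀ j, B14.IsRj L p' ((Cn Pr).flow.g j) (Rj j)) ∧
            HorizonFacts (Cn Pr).flow β' β₀ A₀ L p' κ₀ Rj Pr.K :=
  (betaAvgAFH_of_driftRemainderConst S
    (oneLoopDrift_of_realisedTable S hμν hN hL hR hS hR' hS' hδ hc hM hML hF hG hFtail hGtail hident hid) hrem).endpoint_and_flowControl_allProfiles
    (sub_pos.mpr hr) hgen hhalt hcur hγ₀ hβ' hβ₀ hL2 p hcont hup hκ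

/-- [III] twin of an3's `SquareTable.endpointExistence_of_scalarBounds` — THE THIRD STATEMENT's HEADLINE END FORM: scalar ghost-leg window/decay bounds
`h0 h1 h2 d0 d1 d2` for ONE family `Gf n`, the comparison `hU` against `fullSum (stK μ ν N (Gf (Lc^m)))`, `IdentityForm μC S.β0` ⟹ the [III] list.
[cite: Balaban1987RG1, Thm 2 p.259 and Thm 3 p.264] [cite: Balaban1988Convergent, (2.5)–(2.9) pp.255–256, (2.28) p.259, (2.46) p.263] -/
theorem wallEND_of_scalarBounds_allProfiles {β : HBeta} {Cn : B12.Construction} (hgen : ForwardGenerated Cn β)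
    (hhalt : HaltsOutside Cn β) (hcur : CurriesHBeta Cn β)
    (S : B12Beta.OneLoopSplit β) (hμν : μ ≠ ν) {N : ℝ} (hN : N ≠ 0)
    {Lc : ℕ} (hL : 2 ≤ Lc) {μC : ℕ → ℕ → ℝ} {Gf : ℕ → Pt → ℝ} {D A : ℕ → ℝ} (hD : ∀ j, 0 ≤ D j) (hA : ∀ j, 0 ≤ A j)
    {δ U cc : ℝ} {M : ℕ → ℕ} (hδ : 0 < δ)
    (hc : 1 ≤ cc) (hM : ∀ L : ℕ, 2 ≤ L → 1 ≤ M L ∧ (L : ℝ) ≤ cc * M L) (hML : ∀ L : ℕ, 2 ≤ L → M L ≤ L)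
    (h0 : ∀ n : ℕ, 2 ≤ n → ∀ v, |Gf n v - gFree v| ≤ D 0 / (n : ℝ) ^ 2)
    (h1 : ∀ n : ℕ, 2 ≤ n → ∀ v (ρ : Fin 4),
      |(Gf n (v + unitVec ρ) - gFree (v + unitVec ρ)) - (Gf n v - gFree v)| ≤ D 1 / (n : ℝ) ^ 3)
    (h2 : ∀ n : ℕ, 2 ≤ n → ∀ v,
      |(Gf n (v + unitVec ν + unitVec μ) - gFree (v + unitVec ν + unitVec μ)) - (Gf n (v + unitVec ν) - gFree (v + unitVec ν)) -
          (Gf n (v + unitVec μ) - gFree (v + unitVec μ)) + (Gf n v - gFree v)| ≤ D 2 / (n : ℝ) ^ 4)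
    (d0 : ∀ n : ℕ, 2 ≤ n → ∀ v : Pt, v ≠ 0 → |Gf n v| ≤ A 0 * Real.exp (-(δ / n) * supNorm v) / (supNorm v : ℝ) ^ 2)
    (d1 : ∀ n : ℕ, 2 ≤ n → ∀ v : Pt, v ≠ 0 → ∀ ρ : Fin 4,
      |Gf n (v + unitVec ρ) - Gf n v| ≤ A 1 * Real.exp (-(δ / n) * supNorm v) / (supNorm v : ℝ) ^ 3)
    (d2 : ∀ n : ℕ, 2 ≤ n → ∀ v : Pt, v ≠ 0 →
      |Gf n (v + unitVec ν + unitVec μ) - Gf n (v + unitVec ν) - Gf n (v + unitVec μ) + Gf n v| ≤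
        A 2 * Real.exp (-(δ / n) * supNorm v) / (supNorm v : ℝ) ^ 4)
    (hU : ∀ m : ℕ, 1 ≤ m → |composedCoeff μC m - fullSum (stK μ ν N (Gf (Lc ^ m)))| ≤ U)
    (hid : IdentityForm μC S.β0)
    {rr γ₀ β' β₀ : ℝ} (hγ₀ : 0 < γ₀) (hrem : RemainderConst S γ₀ rr) (hr : rr < B12Normalization.stepBal N Lc)
    (hcont : BetaContH γ₀ β) (hup : BetaUpperH β' γ₀ β) (hβ' : 0 ≤ β') (hβ₀ : 0 < β₀)
    {L : ℕ} (hL2 : 2 ≤ L) (p : ℕ) {κ₀ : ℕ} (hκ : 6 ≤ κ₀) :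
    EndpointExistence Cn ∧ ∃ γ₁ : ℝ, 0 < γ₁ ∧
      ∀ γ : ℝ, 0 < γ → γ ≤ min γ₀ γ₁ → ∀ Pr : B12.RunParams, (Cn Pr).flow.InInterval γ Pr.K →
        ∀ p' : ℕ, p' ≤ p → ∀ A₀ : ℝ, 0 ≤ A₀ →
          ∃ Rj : ℕ → ℕ, (∀ j, B14.IsRj L p' ((Cn Pr).flow.g j) (Rj j)) ∧
            HorizonFacts (Cn Pr).flow β' β₀ A₀ L p' κ₀ Rj Pr.K :=
  (betaAvgAFH_of_driftRemainderConst S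
    (oneLoopDrift_of_scalarBounds S hμν hN hL hD hA hδ hc hM hML h0 h1 h2 d0 d1 d2 hU hid) hrem).endpoint_and_flowControl_allProfiles
    (sub_pos.mpr hr) hgen hhalt hcur hγ₀ hβ' hβ₀ hL2 p hcont hup hκ

/-- [III] twin of an3's `SquareTable.endpointExistence_of_scalarBounds_avg` (base-point-averaged families `Gf n b`, weights `wt`).
[cite: Balaban1987RG1, Thm 2 p.259 and Thm 3 p.264] [cite: Balaban1988Convergent, (2.5)–(2.9) pp.255–256, (2.28) p.259, (2.46) p.263] -/
theorem wallEND_of_scalarBounds_avg_allProfiles {β : HBeta} {Cn : B12.Construction} (hgen : ForwardGenerated Cn β)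
    (hhalt : HaltsOutside Cn β) (hcur : CurriesHBeta Cn β)
    (S : B12Beta.OneLoopSplit β) (hμν : μ ≠ ν) {N : ℝ} (hN : N ≠ 0)
    {Lc : ℕ} (hL : 2 ≤ Lc) {μC : ℕ → ℕ → ℝ} {Bset : ℕ → Finset κB} {wt : ℕ → κB → ℝ} {Gf : ℕ → κB → Pt → ℝ}
    {D A : ℕ → ℝ}
    (hD : ∀ j, 0 ≤ D j) (hA : ∀ j, 0 ≤ A j) {δ U cc : ℝ} {M : ℕ → ℕ} (hδ : 0 < δ)
    (hwt0 : ∀ n : ℕ, 2 ≤ n → ∀ b ∈ Bset n, 0 ≤ wt n b) (hwt1 : ∀ n : ℕ, 2 ≤ n → ∑ b ∈ Bset n, wt n b = 1)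
    (hc : 1 ≤ cc) (hM : ∀ L : ℕ, 2 ≤ L → 1 ≤ M L ∧ (L : ℝ) ≤ cc * M L) (hML : ∀ L : ℕ, 2 ≤ L → M L ≤ L)
    (h0 : ∀ n : ℕ, 2 ≤ n → ∀ b ∈ Bset n, ∀ v, |Gf n b v - gFree v| ≤ D 0 / (n : ℝ) ^ 2)
    (h1 : ∀ n : ℕ, 2 ≤ n → ∀ b ∈ Bset n, ∀ v (ρ : Fin 4),
      |(Gf n b (v + unitVec ρ) - gFree (v + unitVec ρ)) - (Gf n b v - gFree v)| ≤ D 1 / (n : ℝ) ^ 3)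
    (h2 : ∀ n : ℕ, 2 ≤ n → ∀ b ∈ Bset n, ∀ v,
      |(Gf n b (v + unitVec ν + unitVec μ) - gFree (v + unitVec ν + unitVec μ)) - (Gf n b (v + unitVec ν) - gFree (v + unitVec ν)) -
          (Gf n b (v + unitVec μ) - gFree (v + unitVec μ)) + (Gf n b v - gFree v)| ≤ D 2 / (n : ℝ) ^ 4)
    (d0 : ∀ n : ℕ, 2 ≤ n → ∀ b ∈ Bset n, ∀ v : Pt, v ≠ 0 → |Gf n b v| ≤ A 0 * Real.exp (-(δ / n) * supNorm v) / (supNorm v : ℝ) ^ 2)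
    (d1 : ∀ n : ℕ, 2 ≤ n → ∀ b ∈ Bset n, ∀ v : Pt, v ≠ 0 → ∀ ρ : Fin 4,
      |Gf n b (v + unitVec ρ) - Gf n b v| ≤ A 1 * Real.exp (-(δ / n) * supNorm v) / (supNorm v : ℝ) ^ 3)
    (d2 : ∀ n : ℕ, 2 ≤ n → ∀ b ∈ Bset n, ∀ v : Pt, v ≠ 0 →
      |Gf n b (v + unitVec ν + unitVec μ) - Gf n b (v + unitVec ν) - Gf n b (v + unitVec μ) + Gf n b v| ≤
        A 2 * Real.exp (-(δ / n) * supNorm v) / (supNorm v : ℝ) ^ 4)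
    (hU : ∀ m : ℕ, 1 ≤ m → |composedCoeff μC m - ∑ b ∈ Bset (Lc ^ m), wt (Lc ^ m) b * fullSum (stK μ ν N (Gf (Lc ^ m) b))| ≤ U)
    (hid : IdentityForm μC S.β0)
    {rr γ₀ β' β₀ : ℝ} (hγ₀ : 0 < γ₀) (hrem : RemainderConst S γ₀ rr) (hr : rr < B12Normalization.stepBal N Lc)
    (hcont : BetaContH γ₀ β) (hup : BetaUpperH β' γ₀ β) (hβ' : 0 ≤ β') (hβ₀ : 0 < β₀)
    {L : ℕ} (hL2 : 2 ≤ L) (p : ℕ) {κ₀ : ℕ} (hκ : 6 ≤ κ₀) :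
    EndpointExistence Cn ∧ ∃ γ₁ : ℝ, 0 < γ₁ ∧
      ∀ γ : ℝ, 0 < γ → γ ≤ min γ₀ γ₁ → ∀ Pr : B12.RunParams, (Cn Pr).flow.InInterval γ Pr.K →
        ∀ p' : ℕ, p' ≤ p → ∀ A₀ : ℝ, 0 ≤ A₀ →
          ∃ Rj : ℕ → ℕ, (∀ j, B14.IsRj L p' ((Cn Pr).flow.g j) (Rj j)) ∧
            HorizonFacts (Cn Pr).flow β' β₀ A₀ L p' κ₀ Rj Pr.K :=
  (betaAvgAFH_of_driftRemainderConst S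
    (oneLoopDrift_of_scalarBounds_avg S hμν hN hL hD hA hδ hwt0 hwt1 hc hM hML h0 h1 h2 d0 d1 d2 hU hid) hrem).endpoint_and_flowControl_allProfiles
    (sub_pos.mpr hr) hgen hhalt hcur hγ₀ hβ' hβ₀ hL2 p hcont hup hκ

/-- [III] twin of an5's `WallVolumeTransfer.endpointExistence_of_scalarBounds_vol` — the scalar bounds read on finite volumes `GT n t` against `gT n t`
along a filter `l` with pointwise limits `Gf n` / `gFree` (an5's transfer `h0_vol … d2_vol`).
[cite: Balaban1987RG1, Thm 2 p.259 and Thm 3 p.264] [cite: Balaban1988Convergent, (2.5)–(2.9) pp.255–256, (2.28) p.259, (2.46) p.263] -/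
theorem wallEND_of_scalarBounds_vol_allProfiles {β : HBeta} {Cn : B12.Construction} (hgen : ForwardGenerated Cn β)
    (hhalt : HaltsOutside Cn β) (hcur : CurriesHBeta Cn β)
    (S : B12Beta.OneLoopSplit β) (hμν : μ ≠ ν) {N : ℝ} (hN : N ≠ 0)
    {Lc : ℕ} (hL : 2 ≤ Lc) {μC : ℕ → ℕ → ℝ} {GT gT : ℕ → ι → Pt → ℝ} {Gf : ℕ → Pt → ℝ} {D A : ℕ → ℝ}
    (hD : ∀ j, 0 ≤ D j) (hA : ∀ j, 0 ≤ A j) {δ U cc : ℝ} {M : ℕ → ℕ} (hδ : 0 < δ)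
    (hc : 1 ≤ cc) (hM : ∀ L : ℕ, 2 ≤ L → 1 ≤ M L ∧ (L : ℝ) ≤ cc * M L) (hML : ∀ L : ℕ, 2 ≤ L → M L ≤ L)
    (hG : ∀ n : ℕ, 2 ≤ n → ∀ v, Tendsto (fun t => GT n t v) l (𝓝 (Gf n v)))
    (hg : ∀ n : ℕ, 2 ≤ n → ∀ v, Tendsto (fun t => gT n t v) l (𝓝 (gFree v)))
    (h0T : ∀ n : ℕ, 2 ≤ n → ∀ v, ∀ᶠ t in l, |GT n t v - gT n t v| ≤ D 0 / (n : ℝ) ^ 2)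
    (h1T : ∀ n : ℕ, 2 ≤ n → ∀ v (ρ : Fin 4), ∀ᶠ t in l,
      |(GT n t (v + unitVec ρ) - gT n t (v + unitVec ρ)) - (GT n t v - gT n t v)| ≤ D 1 / (n : ℝ) ^ 3)
    (h2T : ∀ n : ℕ, 2 ≤ n → ∀ v, ∀ᶠ t in l,
      |(GT n t (v + unitVec ν + unitVec μ) - gT n t (v + unitVec ν + unitVec μ)) - (GT n t (v + unitVec ν) - gT n t (v + unitVec ν)) -
          (GT n t (v + unitVec μ) - gT n t (v + unitVec μ)) + (GT n t v - gT n t v)| ≤ D 2 / (n : ℝ) ^ 4)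
    (d0T : ∀ n : ℕ, 2 ≤ n → ∀ v : Pt, v ≠ 0 → ∀ᶠ t in l, |GT n t v| ≤ A 0 * Real.exp (-(δ / n) * supNorm v) / (supNorm v : ℝ) ^ 2)
    (d1T : ∀ n : ℕ, 2 ≤ n → ∀ v : Pt, v ≠ 0 → ∀ ρ : Fin 4, ∀ᶠ t in l,
      |GT n t (v + unitVec ρ) - GT n t v| ≤ A 1 * Real.exp (-(δ / n) * supNorm v) / (supNorm v : ℝ) ^ 3)
    (d2T : ∀ n : ℕ, 2 ≤ n → ∀ v : Pt, v ≠ 0 → ∀ᶠ t in l,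
      |GT n t (v + unitVec ν + unitVec μ) - GT n t (v + unitVec ν) - GT n t (v + unitVec μ) + GT n t v| ≤
        A 2 * Real.exp (-(δ / n) * supNorm v) / (supNorm v : ℝ) ^ 4)
    (hU : ∀ m : ℕ, 1 ≤ m → |composedCoeff μC m - fullSum (stK μ ν N (Gf (Lc ^ m)))| ≤ U)
    (hid : IdentityForm μC S.β0)
    {rr γ₀ β' β₀ : ℝ} (hγ₀ : 0 < γ₀) (hrem : RemainderConst S γ₀ rr) (hr : rr < B12Normalization.stepBal N Lc)
    (hcont : BetaContH γ₀ β) (hup : BetaUpperH β' γ₀ β) (hβ' : 0 ≤ β') (hβ₀ : 0 < β₀)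
    {L : ℕ} (hL2 : 2 ≤ L) (p : ℕ) {κ₀ : ℕ} (hκ : 6 ≤ κ₀) :
    EndpointExistence Cn ∧ ∃ γ₁ : ℝ, 0 < γ₁ ∧
      ∀ γ : ℝ, 0 < γ → γ ≤ min γ₀ γ₁ → ∀ Pr : B12.RunParams, (Cn Pr).flow.InInterval γ Pr.K →
        ∀ p' : ℕ, p' ≤ p → ∀ A₀ : ℝ, 0 ≤ A₀ →
          ∃ Rj : ℕ → ℕ, (∀ j, B14.IsRj L p' ((Cn Pr).flow.g j) (Rj j)) ∧
            HorizonFacts (Cn Pr).flow β' β₀ A₀ L p' κ₀ Rj Pr.K :=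
  wallEND_of_scalarBounds_allProfiles hgen hhalt hcur S hμν hN hL hD hA hδ hc hM hML (h0_vol hG hg h0T) (h1_vol hG hg h1T) (h2_vol hG hg h2T)
    (d0_vol hG d0T) (d1_vol hG d1T) (d2_vol hG d2T) hU hid hγ₀ hrem hr hcont hup hβ' hβ₀
    hL2 p hκ

/-- [III] twin of an5's `WallVolumeTransfer.endpointExistence_of_scalarBounds_avg_vol` (base-point-averaged, infinite-volume transfer).
[cite: Balaban1987RG1, Thm 2 p.259 and Thm 3 p.264] [cite: Balaban1988Convergent, (2.5)–(2.9) pp.255–256, (2.28) p.259, (2.46) p.263] -/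
theorem wallEND_of_scalarBounds_avg_vol_allProfiles {β : HBeta} {Cn : B12.Construction} (hgen : ForwardGenerated Cn β)
    (hhalt : HaltsOutside Cn β) (hcur : CurriesHBeta Cn β)
    (S : B12Beta.OneLoopSplit β) (hμν : μ ≠ ν) {N : ℝ} (hN : N ≠ 0)
    {Lc : ℕ} (hL : 2 ≤ Lc) {μC : ℕ → ℕ → ℝ} {Bset : ℕ → Finset κB} {wt : ℕ → κB → ℝ}
    {GT gT : ℕ → κB → ι → Pt → ℝ} {Gf : ℕ → κB → Pt → ℝ} {D A : ℕ → ℝ}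
    (hD : ∀ j, 0 ≤ D j) (hA : ∀ j, 0 ≤ A j) {δ U cc : ℝ} {M : ℕ → ℕ} (hδ : 0 < δ)
    (hwt0 : ∀ n : ℕ, 2 ≤ n → ∀ b ∈ Bset n, 0 ≤ wt n b) (hwt1 : ∀ n : ℕ, 2 ≤ n → ∑ b ∈ Bset n, wt n b = 1)
    (hc : 1 ≤ cc) (hM : ∀ L : ℕ, 2 ≤ L → 1 ≤ M L ∧ (L : ℝ) ≤ cc * M L) (hML : ∀ L : ℕ, 2 ≤ L → M L ≤ L)
    (hG : ∀ n : ℕ, 2 ≤ n → ∀ b ∈ Bset n, ∀ v, Tendsto (fun t => GT n b t v) l (𝓝 (Gf n b v)))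
    (hg : ∀ n : ℕ, 2 ≤ n → ∀ b ∈ Bset n, ∀ v, Tendsto (fun t => gT n b t v) l (𝓝 (gFree v)))
    (h0T : ∀ n : ℕ, 2 ≤ n → ∀ b ∈ Bset n, ∀ v, ∀ᶠ t in l, |GT n b t v - gT n b t v| ≤ D 0 / (n : ℝ) ^ 2)
    (h1T : ∀ n : ℕ, 2 ≤ n → ∀ b ∈ Bset n, ∀ v (ρ : Fin 4), ∀ᶠ t in l,
      |(GT n b t (v + unitVec ρ) - gT n b t (v + unitVec ρ)) - (GT n b t v - gT n b t v)| ≤ D 1 / (n : ℝ) ^ 3)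
    (h2T : ∀ n : ℕ, 2 ≤ n → ∀ b ∈ Bset n, ∀ v, ∀ᶠ t in l,
      |(GT n b t (v + unitVec ν + unitVec μ) - gT n b t (v + unitVec ν + unitVec μ)) -
          (GT n b t (v + unitVec ν) - gT n b t (v + unitVec ν)) - (GT n b t (v + unitVec μ) - gT n b t (v + unitVec μ)) +
          (GT n b t v - gT n b t v)| ≤ D 2 / (n : ℝ) ^ 4)
    (d0T : ∀ n : ℕ, 2 ≤ n → ∀ b ∈ Bset n, ∀ v : Pt, v ≠ 0 → ∀ᶠ t in l,
      |GT n b t v| ≤ A 0 * Real.exp (-(δ / n) * supNorm v) / (supNorm v : ℝ) ^ 2)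
    (d1T : ∀ n : ℕ, 2 ≤ n → ∀ b ∈ Bset n, ∀ v : Pt, v ≠ 0 → ∀ ρ : Fin 4, ∀ᶠ t in l,
      |GT n b t (v + unitVec ρ) - GT n b t v| ≤ A 1 * Real.exp (-(δ / n) * supNorm v) / (supNorm v : ℝ) ^ 3)
    (d2T : ∀ n : ℕ, 2 ≤ n → ∀ b ∈ Bset n, ∀ v : Pt, v ≠ 0 → ∀ᶠ t in l,
      |GT n b t (v + unitVec ν + unitVec μ) - GT n b t (v + unitVec ν) - GT n b t (v + unitVec μ) + GT n b t v| ≤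
        A 2 * Real.exp (-(δ / n) * supNorm v) / (supNorm v : ℝ) ^ 4)
    (hU : ∀ m : ℕ, 1 ≤ m → |composedCoeff μC m - ∑ b ∈ Bset (Lc ^ m), wt (Lc ^ m) b * fullSum (stK μ ν N (Gf (Lc ^ m) b))| ≤ U)
    (hid : IdentityForm μC S.β0)
    {rr γ₀ β' β₀ : ℝ} (hγ₀ : 0 < γ₀) (hrem : RemainderConst S γ₀ rr) (hr : rr < B12Normalization.stepBal N Lc)
    (hcont : BetaContH γ₀ β) (hup : BetaUpperH β' γ₀ β) (hβ' : 0 ≤ β') (hβ₀ : 0 < β₀)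
    {L : ℕ} (hL2 : 2 ≤ L) (p : ℕ) {κ₀ : ℕ} (hκ : 6 ≤ κ₀) :
    EndpointExistence Cn ∧ ∃ γ₁ : ℝ, 0 < γ₁ ∧
      ∀ γ : ℝ, 0 < γ → γ ≤ min γ₀ γ₁ → ∀ Pr : B12.RunParams, (Cn Pr).flow.InInterval γ Pr.K →
        ∀ p' : ℕ, p' ≤ p → ∀ A₀ : ℝ, 0 ≤ A₀ →
          ∃ Rj : ℕ → ℕ, (∀ j, B14.IsRj L p' ((Cn Pr).flow.g j) (Rj j)) ∧
            HorizonFacts (Cn Pr).flow β' β₀ A₀ L p' κ₀ Rj Pr.K :=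
  wallEND_of_scalarBounds_avg_allProfiles hgen hhalt hcur S hμν hN hL hD hA hδ hwt0 hwt1 hc hM hML (h0_avg_vol hG hg h0T) (h1_avg_vol hG hg h1T)
    (h2_avg_vol hG hg h2T) (d0_avg_vol hG d0T) (d1_avg_vol hG d1T) (d2_avg_vol hG d2T) hU hid hγ₀ hrem hr hcont hup
    hβ' hβ₀ hL2 p hκ

end ScalarBase

/-! ## §6 (v1.4) THE SCALE-WISE ONE-SHOT FORM OF (D1) ON THE VECTOR ROAD, [III] SIDE — the EXIT-B socket of RULING (R18-1)
(lead `Beta/ScalewiseVectorSeam`, p185521; RULING (R17): on the vector road the located analytic items are (D1), (D4), (D5) — NO leg-row, Γ-row or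
volume-limit binder)

The lead's `ScalewiseVectorSeam.endpointExistence_of_scalewise_vectorSeam[_of_symmetries]` is an5-g9's `endpointExistence_of_vectorTails_evenVolume`
at the TRIVIAL instance `μC := fun j _ => Sβ.β0 j`, `hid := rfl`, with the vector road's full-sum `hU` SUPPLIED from an2's SCALE-WISE one-loop data —
Hessian kernels `T j` / one-shot kernels `𝒯 m` (`AbsMoment₂` + (T0)/(T1), or divergence-freeness + midpoint inversion), an additive read-out `F` with
`hβ : Sβ.β0 j = F (m2Tensor (T j))`, (N1-B) `HessianTelescoping Lc T 𝒯` — and ONE full-sum comparison per scale `OneShotFullSum Lc F 𝒯 N μ ν a SL k U`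
(the one-shot read-out vs the base-point-averaged K^∞ full sums; = (D1) in its EXIT-B type: once brick (T-def) supplies the GENUINE `T := Tbal`,
`𝒯 := 𝒯bal`, `F := Fbal` with `β⁰_j` DEFINED as the read-out, `htel`/`hrep` ARE the closed Props `D1Tel`/`D1Rep` of (R18-1)).  Here is the [III] side:
§4's `wallEND_of_vectorTails_evenVolume_allProfiles` at the same instance with `hU := hU_of_scalewise …` (resp. `hU_of_scalewise_of_symmetries …`),
`hid := identityForm_trivial Sβ.β0`.  Binders = the lead's VERBATIM + the [III] deltas (`(hhalt) (hcur)` after `hgen`; `hr : rr < stepBal N Lc` STRICT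
— (2.46), `ConstRemainderConsumers.Margin.sum246_fails` at equality —; `hβ'` behind `hup`; `{β₀} (hβ₀) {L : ℕ} (hL2) (p) {κ₀} (hκ)`; label type `Λ`).
NO FREE LUNCH (RULING (R16-1), lead's `oneShotFullSum_iff_hU_of_telescoping`): `(T, F, hβ)` are inhabited for every β⁰; content arises only for the
GENUINE kernels of (T-def).  READING CLAUSE (W-KKT-2) as in the lead's header.  [folklore] composition; discharges NOTHING for Bałaban's objects;
NOT summit progress. -/

section ScalewiseVectorSeam

open Literature.MathematicalPhysics.QuantumFieldTheory.Balaban1983to89.Beta.VectorLegVolumeAdapter (MvE GfE)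
open Literature.MathematicalPhysics.QuantumFieldTheory.Balaban1983to89.Beta.DecimatedMomentSummable (AbsMoment₂)
open Literature.MathematicalPhysics.QuantumFieldTheory.Balaban1983to89.Beta.DressedMomentNormalisation (EKer m2Tensor)
open Literature.MathematicalPhysics.QuantumFieldTheory.Balaban1983to89.Beta.HidentScalewise (Tensor4 HessianTelescoping identityForm_trivial)
open Literature.MathematicalPhysics.QuantumFieldTheory.Balaban1983to89.Beta.ScalewiseVectorSeam
  (OneShotFullSum hU_of_scalewise hU_of_scalewise_of_symmetries)

variable {Λ : Type*}

/-- **THE SCALE-WISE ONE-SHOT FORM ON THE VECTOR ROAD ⟹ THE WHOLE LOCATED [III] LIST** — the [III]-side twin of the lead's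
`ScalewiseVectorSeam.endpointExistence_of_scalewise_vectorSeam` (EXIT-B socket, RULING (R18-1)).  From EXACTLY: the two printed Props BY NAME
(`h12`, `h126` — (α)-leaves, [Balaban1984PropagatorsI] Prop. 1.2 p. 35 and (1.126)–(1.127) p. 38, printed with proof), base-point labels `hSL`/`k`,
table/window data (`hμν hN hL hc hM hML`), the scale-wise one-loop data (`T 𝒯 hTA hT0 hT1 F hFadd hβ htel`), `hrep : OneShotFullSum …` (= (D1) in
EXIT-B type), (D4) `hrem` + `hr : rr < stepBal N Lc` STRICT, (D5) `hcont` + `hup`/`hβ'`, `hγ₀`, the structural `hgen` + the [III] run-side `hhalt hcur`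
and profile data `β₀ > 0`, `L ≥ 2`, `p`, `κ₀ ≥ 6` ⟹ `EndpointExistence Cn ∧ ∃ γ₁ > 0, ∀ γ ≤ min γ₀ γ₁, ∀ runs in ]0,γ], ∀ p′ ≤ p, ∀ A₀ ≥ 0: sizes ∧
HorizonFacts` ((2.6)–(2.9) + (2.46) of [III], every β₀ > 0).  Proof: §4 at `μC := fun j _ => Sβ.β0 j` with `hU := hU_of_scalewise …`,
`hid := identityForm_trivial Sβ.β0`.  The lead's `EndpointExistence Cn` is the conjunct `.1` (it takes `hr.le`).
[cite: Balaban1987RG1, Thm 2 p.259 and Thm 3 p.264] [cite: Balaban1988Convergent, (2.5)–(2.9) pp.255–256, (2.28) p.259, (2.46) p.263] -/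
theorem wallEND_of_scalewise_vectorSeam_allProfiles (a : ℝ) (ha : 0 < a)
    (h12 : B5.Prop12Printed (fam (fun i : ℕ+ × ℕ => ((i.1 : ℕ+) : ℕ)) (fun i => i.1.pos) MvE a ha))
    (h126 : B5.Kernel126_127Printed (kfam (fun i : ℕ+ × ℕ => ((i.1 : ℕ+) : ℕ)) MvE))
    {SL : Finset Λ} (hSL : SL.Nonempty) (k : Λ → Fin 4) {μ ν : Fin 4}
    {β : HBeta} {Cn : B12.Construction} (hgen : ForwardGenerated Cn β) (hhalt : HaltsOutside Cn β) (hcur : CurriesHBeta Cn β)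
    (Sβ : B12Beta.OneLoopSplit β) (hμν : μ ≠ ν) {N : ℝ} (hN : N ≠ 0) {Lc : ℕ} [NeZero Lc] (hL : 2 ≤ Lc)
    -- the scale-wise one-loop data (an2 `HidentScalewise`)
    (T 𝒯 : ℕ → EKer 4) (hTA : ∀ j c e, AbsMoment₂ (T j c e))
    (hT0 : ∀ j c e, HasSum (T j c e) 0)
    (hT1 : ∀ j c e (ρ : Fin 4), HasSum (fun t : Fin 4 → ℤ => t ρ • T j c e t) 0)
    (F : Tensor4 → ℝ) (hFadd : ∀ A B, F (A + B) = F A + F B) (hβ : ∀ j, Sβ.β0 j = F (m2Tensor (T j)))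
    (htel : HessianTelescoping Lc T 𝒯)
    -- window data of the vector seam
    {U cc : ℝ} {M : ℕ → ℕ}
    (hc : 1 ≤ cc) (hM : ∀ L : ℕ, 2 ≤ L → 1 ≤ M L ∧ (L : ℝ) ≤ cc * M L) (hML : ∀ L : ℕ, 2 ≤ L → M L ≤ L)
    -- (D1) in EXIT-B type: ONE full-sum comparison per scale for the one-shot Hessian kernel against the K^∞ legs
    (hrep : OneShotFullSum Lc F 𝒯 N μ ν a SL k U)
    {rr γ₀ β' β₀ : ℝ} (hγ₀ : 0 < γ₀) (hrem : RemainderConst Sβ γ₀ rr) (hr : rr < B12Normalization.stepBal N Lc)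
    (hcont : BetaContH γ₀ β) (hup : BetaUpperH β' γ₀ β) (hβ' : 0 ≤ β') (hβ₀ : 0 < β₀)
    {L : ℕ} (hL2 : 2 ≤ L) (p : ℕ) {κ₀ : ℕ} (hκ : 6 ≤ κ₀) :
    EndpointExistence Cn ∧ ∃ γ₁ : ℝ, 0 < γ₁ ∧
      ∀ γ : ℝ, 0 < γ → γ ≤ min γ₀ γ₁ → ∀ Pr : B12.RunParams, (Cn Pr).flow.InInterval γ Pr.K →
        ∀ p' : ℕ, p' ≤ p → ∀ A₀ : ℝ, 0 ≤ A₀ →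
          ∃ Rj : ℕ → ℕ, (∀ j, B14.IsRj L p' ((Cn Pr).flow.g j) (Rj j)) ∧
            HorizonFacts (Cn Pr).flow β' β₀ A₀ L p' κ₀ Rj Pr.K :=
  wallEND_of_vectorTails_evenVolume_allProfiles a ha h12 h126 hSL k hgen hhalt hcur Sβ hμν hN hL (μC := fun j _ => Sβ.β0 j)
    hc hM hML (hU_of_scalewise hTA hT0 hT1 htel hFadd hβ hrep) (identityForm_trivial Sβ.β0) hγ₀ hrem hr hcont hup hβ' hβ₀
    hL2 p hκ

/-- **… with (T0)/(T1) from divergence-freeness + midpoint inversion** of the Hessian kernels — the [III]-side twin of the lead's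
`endpointExistence_of_scalewise_vectorSeam_of_symmetries` (`hU := hU_of_scalewise_of_symmetries …`).
[cite: Balaban1987RG1, Thm 2 p.259 and Thm 3 p.264] [cite: Balaban1988Convergent, (2.5)–(2.9) pp.255–256, (2.28) p.259, (2.46) p.263] -/
theorem wallEND_of_scalewise_vectorSeam_of_symmetries_allProfiles (a : ℝ) (ha : 0 < a)
    (h12 : B5.Prop12Printed (fam (fun i : ℕ+ × ℕ => ((i.1 : ℕ+) : ℕ)) (fun i => i.1.pos) MvE a ha))
    (h126 : B5.Kernel126_127Printed (kfam (fun i : ℕ+ × ℕ => ((i.1 : ℕ+) : ℕ)) MvE))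
    {SL : Finset Λ} (hSL : SL.Nonempty) (k : Λ → Fin 4) {μ ν : Fin 4}
    {β : HBeta} {Cn : B12.Construction} (hgen : ForwardGenerated Cn β) (hhalt : HaltsOutside Cn β) (hcur : CurriesHBeta Cn β)
    (Sβ : B12Beta.OneLoopSplit β) (hμν : μ ≠ ν) {N : ℝ} (hN : N ≠ 0) {Lc : ℕ} [NeZero Lc] (hL : 2 ≤ Lc)
    -- the scale-wise one-loop data (an2 `HidentScalewise`)
    (T 𝒯 : ℕ → EKer 4) (hTA : ∀ j c e, AbsMoment₂ (T j c e))
    (hdiv : ∀ j (ν' : Fin 4) (x : Fin 4 → ℤ), ∑ μ', (T j μ' ν' x - T j μ' ν' (x - Pi.single μ' 1)) = 0)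
    (hinv : ∀ j (μ' ν' : Fin 4) (y : Fin 4 → ℤ), T j μ' ν' ((Pi.single ν' 1 - Pi.single μ' 1) - y) = T j μ' ν' y)
    (F : Tensor4 → ℝ) (hFadd : ∀ A B, F (A + B) = F A + F B) (hβ : ∀ j, Sβ.β0 j = F (m2Tensor (T j)))
    (htel : HessianTelescoping Lc T 𝒯)
    -- window data of the vector seam
    {U cc : ℝ} {M : ℕ → ℕ}
    (hc : 1 ≤ cc) (hM : ∀ L : ℕ, 2 ≤ L → 1 ≤ M L ∧ (L : ℝ) ≤ cc * M L) (hML : ∀ L : ℕ, 2 ≤ L → M L ≤ L)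
    -- (D1) in EXIT-B type: ONE full-sum comparison per scale for the one-shot Hessian kernel against the K^∞ legs
    (hrep : OneShotFullSum Lc F 𝒯 N μ ν a SL k U)
    {rr γ₀ β' β₀ : ℝ} (hγ₀ : 0 < γ₀) (hrem : RemainderConst Sβ γ₀ rr) (hr : rr < B12Normalization.stepBal N Lc)
    (hcont : BetaContH γ₀ β) (hup : BetaUpperH β' γ₀ β) (hβ' : 0 ≤ β') (hβ₀ : 0 < β₀)
    {L : ℕ} (hL2 : 2 ≤ L) (p : ℕ) {κ₀ : ℕ} (hκ : 6 ≤ κ₀) :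
    EndpointExistence Cn ∧ ∃ γ₁ : ℝ, 0 < γ₁ ∧
      ∀ γ : ℝ, 0 < γ → γ ≤ min γ₀ γ₁ → ∀ Pr : B12.RunParams, (Cn Pr).flow.InInterval γ Pr.K →
        ∀ p' : ℕ, p' ≤ p → ∀ A₀ : ℝ, 0 ≤ A₀ →
          ∃ Rj : ℕ → ℕ, (∀ j, B14.IsRj L p' ((Cn Pr).flow.g j) (Rj j)) ∧
            HorizonFacts (Cn Pr).flow β' β₀ A₀ L p' κ₀ Rj Pr.K :=
  wallEND_of_vectorTails_evenVolume_allProfiles a ha h12 h126 hSL k hgen hhalt hcur Sβ hμν hN hL (μC := fun j _ => Sβ.β0 j)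
    hc hM hML (hU_of_scalewise_of_symmetries hTA hdiv hinv htel hFadd hβ hrep) (identityForm_trivial Sβ.β0) hγ₀ hrem hr
    hcont hup hβ' hβ₀ hL2 p hκ

end ScalewiseVectorSeam

/-! ## §7 (v1.5) THE PRINTED READ-OUT (1.22) IN THE EXIT-B SOCKET, [III] SIDE — RULING (R20-3) «Fbal := the typed (1.22) read-out» BY NAME
(lead `Beta/ScalewiseVectorSeam` v1.2 §5, p186248)

The lead's §5 instantiates the socket's additive read-out `F` with the coordinate functional `readout122 μ ν M := M μ ν μ ν` and proves
`readout122_m2Tensor : readout122 μ ν (m2Tensor T) = B12Beta.secondMoment T μ ν` — the diagonal-pair entry of the second-moment tensor IS the PRINTED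
(1.22) second moment `Σ_x Π_{μν}(x) x_μ x_ν` ([Balaban1987RG1] p. 264 (1.22), quoted and typed in `B12Beta`, not re-quoted here) —, so that the one-loop
read-out binder takes the printed form `hβ : ∀ j, Sβ.β0 j = secondMoment (T j) μ ν` and `D1Rep` the form
`∀ m ≥ 1, |secondMoment (𝒯 m) μ ν − oneShotSide SL μ ν N a k (Lc^m)| ≤ U` (`oneShotFullSum_readout122_iff`); no abstract read-out is left in EXIT-B.
Here is the [III] side: §6's `wallEND_of_scalewise_vectorSeam[_of_symmetries]_allProfiles` at `F := readout122 μ ν`, `hFadd := readout122_add μ ν`,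
`hβ` rewritten along `readout122_m2Tensor`, `hrep := oneShotFullSum_readout122_iff.mpr hrep` — ONE application each, the SAME terms as the lead's §5 with
the END socket swapped.  Binders = the lead's `endpointExistence_of_scalewise_vectorSeam_readout122[_of_symmetries]` VERBATIM + the [III] deltas of §6
(`(hhalt) (hcur)` after `hgen`; `hr : rr < stepBal N Lc` STRICT; `hβ'` behind `hup`; `{β₀} (hβ₀) {L : ℕ} (hL2) (p) {κ₀} (hκ)`; label type `Λ`); the lead's
`EndpointExistence Cn` is the conjunct `.1` (it takes `hr.le`).  NO FREE LUNCH / READING CLAUSE (W-KKT-2) as in §6 and the lead's header: content arises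
only for the GENUINE kernels `Tbal`/`𝒯bal` of brick (T-def), for which `β⁰_j := secondMoment (Tbal j) μ ν` makes `hβ := fun _ => rfl`.  [folklore]
composition; discharges NOTHING for Bałaban's objects; NOT `BetaPertH`, NOT summit progress, never continuum / mass gap / Clay. -/

section Readout122

open Literature.MathematicalPhysics.QuantumFieldTheory.Balaban1983to89.Beta.VectorLegVolumeAdapter (MvE)
open Literature.MathematicalPhysics.QuantumFieldTheory.Balaban1983to89.Beta.DecimatedMomentSummable (AbsMoment₂)
open Literature.MathematicalPhysics.QuantumFieldTheory.Balaban1983to89.Beta.DressedMomentNormalisation (EKer)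
open Literature.MathematicalPhysics.QuantumFieldTheory.Balaban1983to89.Beta.HidentScalewise (HessianTelescoping)
open Literature.MathematicalPhysics.QuantumFieldTheory.Balaban1983to89.Beta.ScalewiseVectorSeam
  (oneShotSide readout122 readout122_add readout122_m2Tensor oneShotFullSum_readout122_iff)
open Literature.MathematicalPhysics.QuantumFieldTheory.Balaban1983to89.B12Beta (secondMoment)

variable {Λ : Type*}

/-- **THE EXIT-B SOCKET WITH THE PRINTED (1.22) READ-OUT ⟹ THE WHOLE LOCATED [III] LIST** — the [III]-side twin of the lead's
`ScalewiseVectorSeam.endpointExistence_of_scalewise_vectorSeam_readout122` (RULING (R20-3)).  From EXACTLY: the two printed Props BY NAME (`h12`,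
`h126` — (α)-leaves, [Balaban1984PropagatorsI] Prop. 1.2 p. 35 and (1.126)–(1.127) p. 38, printed with proof), base-point labels `hSL`/`k`, table/window
data (`hμν hN hL hc hM hML`), the scale-wise one-loop data (`T 𝒯 hTA hT0 hT1 htel`) read out by the PRINTED (1.22) second moment
(`hβ : ∀ j, Sβ.β0 j = secondMoment (T j) μ ν`), `hrep : ∀ m ≥ 1, |secondMoment (𝒯 m) μ ν − oneShotSide SL μ ν N a k (Lc^m)| ≤ U` (= `D1Rep` of (R20-3)),
(D4) `hrem` + `hr : rr < stepBal N Lc` STRICT, (D5) `hcont` + `hup`/`hβ'`, `hγ₀`, the structural `hgen` + the [III] run-side `hhalt hcur` and profile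
data `β₀ > 0`, `L ≥ 2`, `p`, `κ₀ ≥ 6` ⟹ `EndpointExistence Cn ∧ ∃ γ₁ > 0, ∀ γ ≤ min γ₀ γ₁, ∀ runs in ]0,γ], ∀ p′ ≤ p, ∀ A₀ ≥ 0: sizes ∧ HorizonFacts`
((2.6)–(2.9) + (2.46) of [III], every β₀ > 0).  Proof: §6's `wallEND_of_scalewise_vectorSeam_allProfiles` at `F := readout122 μ ν`.
[cite: Balaban1987RG1, Thm 2 p.259 and Thm 3 p.264] [cite: Balaban1988Convergent, (2.5)–(2.9) pp.255–256, (2.28) p.259, (2.46) p.263] -/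
theorem wallEND_of_scalewise_vectorSeam_readout122_allProfiles (a : ℝ) (ha : 0 < a)
    (h12 : B5.Prop12Printed (fam (fun i : ℕ+ × ℕ => ((i.1 : ℕ+) : ℕ)) (fun i => i.1.pos) MvE a ha))
    (h126 : B5.Kernel126_127Printed (kfam (fun i : ℕ+ × ℕ => ((i.1 : ℕ+) : ℕ)) MvE))
    {SL : Finset Λ} (hSL : SL.Nonempty) (k : Λ → Fin 4) {μ ν : Fin 4}
    {β : HBeta} {Cn : B12.Construction} (hgen : ForwardGenerated Cn β) (hhalt : HaltsOutside Cn β) (hcur : CurriesHBeta Cn β)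
    (Sβ : B12Beta.OneLoopSplit β) (hμν : μ ≠ ν) {N : ℝ} (hN : N ≠ 0) {Lc : ℕ} [NeZero Lc] (hL : 2 ≤ Lc)
    -- the scale-wise one-loop data (an2 `HidentScalewise`), read out by the PRINTED (1.22) second moment
    (T 𝒯 : ℕ → EKer 4) (hTA : ∀ j c e, AbsMoment₂ (T j c e))
    (hT0 : ∀ j c e, HasSum (T j c e) 0)
    (hT1 : ∀ j c e (ρ : Fin 4), HasSum (fun t : Fin 4 → ℤ => t ρ • T j c e t) 0)
    (hβ : ∀ j, Sβ.β0 j = secondMoment (T j) μ ν)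
    (htel : HessianTelescoping Lc T 𝒯)
    -- window data of the vector seam
    {U cc : ℝ} {M : ℕ → ℕ}
    (hc : 1 ≤ cc) (hM : ∀ L : ℕ, 2 ≤ L → 1 ≤ M L ∧ (L : ℝ) ≤ cc * M L) (hML : ∀ L : ℕ, 2 ≤ L → M L ≤ L)
    -- (D1) in EXIT-B type with the printed read-out: `D1Rep` of RULING (R20-3)
    (hrep : ∀ m : ℕ, 1 ≤ m → |secondMoment (𝒯 m) μ ν - oneShotSide SL μ ν N a k (Lc ^ m)| ≤ U)
    {rr γ₀ β' β₀ : ℝ} (hγ₀ : 0 < γ₀) (hrem : RemainderConst Sβ γ₀ rr) (hr : rr < B12Normalization.stepBal N Lc)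
    (hcont : BetaContH γ₀ β) (hup : BetaUpperH β' γ₀ β) (hβ' : 0 ≤ β') (hβ₀ : 0 < β₀)
    {L : ℕ} (hL2 : 2 ≤ L) (p : ℕ) {κ₀ : ℕ} (hκ : 6 ≤ κ₀) :
    EndpointExistence Cn ∧ ∃ γ₁ : ℝ, 0 < γ₁ ∧
      ∀ γ : ℝ, 0 < γ → γ ≤ min γ₀ γ₁ → ∀ Pr : B12.RunParams, (Cn Pr).flow.InInterval γ Pr.K →
        ∀ p' : ℕ, p' ≤ p → ∀ A₀ : ℝ, 0 ≤ A₀ →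
          ∃ Rj : ℕ → ℕ, (∀ j, B14.IsRj L p' ((Cn Pr).flow.g j) (Rj j)) ∧
            HorizonFacts (Cn Pr).flow β' β₀ A₀ L p' κ₀ Rj Pr.K :=
  wallEND_of_scalewise_vectorSeam_allProfiles a ha h12 h126 hSL k hgen hhalt hcur Sβ hμν hN hL T 𝒯 hTA hT0 hT1 (readout122 μ ν)
    (readout122_add μ ν) (fun j => by rw [readout122_m2Tensor]; exact hβ j) htel hc hM hML
    (oneShotFullSum_readout122_iff.mpr hrep) hγ₀ hrem hr hcont hup hβ' hβ₀ hL2 p hκ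

/-- **… with (T0)/(T1) from divergence-freeness + midpoint inversion** of the Hessian kernels — the [III]-side twin of the lead's
`endpointExistence_of_scalewise_vectorSeam_readout122_of_symmetries` (§6's `wallEND_of_scalewise_vectorSeam_of_symmetries_allProfiles` at
`F := readout122 μ ν`).
[cite: Balaban1987RG1, Thm 2 p.259 and Thm 3 p.264] [cite: Balaban1988Convergent, (2.5)–(2.9) pp.255–256, (2.28) p.259, (2.46) p.263] -/
theorem wallEND_of_scalewise_vectorSeam_readout122_of_symmetries_allProfiles (a : ℝ) (ha : 0 < a)
    (h12 : B5.Prop12Printed (fam (fun i : ℕ+ × ℕ => ((i.1 : ℕ+) : ℕ)) (fun i => i.1.pos) MvE a ha))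
    (h126 : B5.Kernel126_127Printed (kfam (fun i : ℕ+ × ℕ => ((i.1 : ℕ+) : ℕ)) MvE))
    {SL : Finset Λ} (hSL : SL.Nonempty) (k : Λ → Fin 4) {μ ν : Fin 4}
    {β : HBeta} {Cn : B12.Construction} (hgen : ForwardGenerated Cn β) (hhalt : HaltsOutside Cn β) (hcur : CurriesHBeta Cn β)
    (Sβ : B12Beta.OneLoopSplit β) (hμν : μ ≠ ν) {N : ℝ} (hN : N ≠ 0) {Lc : ℕ} [NeZero Lc] (hL : 2 ≤ Lc)
    -- the scale-wise one-loop data (an2 `HidentScalewise`), read out by the PRINTED (1.22) second moment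
    (T 𝒯 : ℕ → EKer 4) (hTA : ∀ j c e, AbsMoment₂ (T j c e))
    (hdiv : ∀ j (ν' : Fin 4) (x : Fin 4 → ℤ), ∑ μ', (T j μ' ν' x - T j μ' ν' (x - Pi.single μ' 1)) = 0)
    (hinv : ∀ j (μ' ν' : Fin 4) (y : Fin 4 → ℤ), T j μ' ν' ((Pi.single ν' 1 - Pi.single μ' 1) - y) = T j μ' ν' y)
    (hβ : ∀ j, Sβ.β0 j = secondMoment (T j) μ ν)
    (htel : HessianTelescoping Lc T 𝒯)
    -- window data of the vector seam
    {U cc : ℝ} {M : ℕ → ℕ}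
    (hc : 1 ≤ cc) (hM : ∀ L : ℕ, 2 ≤ L → 1 ≤ M L ∧ (L : ℝ) ≤ cc * M L) (hML : ∀ L : ℕ, 2 ≤ L → M L ≤ L)
    -- (D1) in EXIT-B type with the printed read-out: `D1Rep` of RULING (R20-3)
    (hrep : ∀ m : ℕ, 1 ≤ m → |secondMoment (𝒯 m) μ ν - oneShotSide SL μ ν N a k (Lc ^ m)| ≤ U)
    {rr γ₀ β' β₀ : ℝ} (hγ₀ : 0 < γ₀) (hrem : RemainderConst Sβ γ₀ rr) (hr : rr < B12Normalization.stepBal N Lc)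
    (hcont : BetaContH γ₀ β) (hup : BetaUpperH β' γ₀ β) (hβ' : 0 ≤ β') (hβ₀ : 0 < β₀)
    {L : ℕ} (hL2 : 2 ≤ L) (p : ℕ) {κ₀ : ℕ} (hκ : 6 ≤ κ₀) :
    EndpointExistence Cn ∧ ∃ γ₁ : ℝ, 0 < γ₁ ∧
      ∀ γ : ℝ, 0 < γ → γ ≤ min γ₀ γ₁ → ∀ Pr : B12.RunParams, (Cn Pr).flow.InInterval γ Pr.K →
        ∀ p' : ℕ, p' ≤ p → ∀ A₀ : ℝ, 0 ≤ A₀ →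
          ∃ Rj : ℕ → ℕ, (∀ j, B14.IsRj L p' ((Cn Pr).flow.g j) (Rj j)) ∧
            HorizonFacts (Cn Pr).flow β' β₀ A₀ L p' κ₀ Rj Pr.K :=
  wallEND_of_scalewise_vectorSeam_of_symmetries_allProfiles a ha h12 h126 hSL k hgen hhalt hcur Sβ hμν hN hL T 𝒯 hTA hdiv hinv
    (readout122 μ ν) (readout122_add μ ν) (fun j => by rw [readout122_m2Tensor]; exact hβ j) htel hc hM hML
    (oneShotFullSum_readout122_iff.mpr hrep) hγ₀ hrem hr hcont hup hβ' hβ₀ hL2 p hκ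

end Readout122

/-! ## §8 (v1.6) RULINGS (R22)/(R23) ON THE VECTOR ROAD, [III] SIDE — the carrier from the socket data + (D4) alone; (D5) = (C) only; β′ DERIVED
(lead `Beta/ScalewiseVectorSeam` v1.5 §7 «THE DRIFT EXPOSED», p186611; an4 `Beta/DriftRemainder` v1.1 §6, p186633)

RULING (R22): every road of the wall derives the DRIFT `OneLoopDrift (stepBal N Lc) A β⁰` (|Σ_{j<k} β⁰_j − k·stepBal N Lc| ≤ A for all k) BEFORE touching
(D4)/(D5) — on the vector road by the lead's `oneLoopDrift_of_vectorTails_evenVolume` (here fed, as in the lead's §7/§8, with `hU_of_scalewise` at the trivial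
instance `μC := fun j _ => Sβ.β0 j`, `identityForm_trivial`) —, and on the drift road the printed-type upper bound is NOT an independent input: an4's
`betaUpperH_of_drift_remainderConst : BetaUpperH (stepBal + 2A + rr) γ₀ β`, `upperConst_nonneg : 0 ≤ stepBal + 2A + rr` (given `rr ≤ stepBal`, `0 < γ₀`).  Row (D5)
of the wall := (C) `BetaContH γ₀ β` alone.  RULING (R23): at END grade the one-loop item IS that drift (`D1Drift`); the lead's v1.6 re-exports an4's
`endpointExistence_of_drift_remainderConst_cont` as the END from FOUR binders.  ON THE [III] SIDE (this section, convention-free socket level — the abstract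
scale-wise data `T 𝒯 hTA hT0 hT1 F hFadd hβ htel` + `OneShotFullSum`; the printed-read-out / kernel-convention forms follow the lead's v1.6 in a later version):
* `betaAvgAFH_of_scalewise_vectorSeam` — socket data + (D4) `RemainderConst Sβ γ₀ rr` ALONE ⟹ `∃ A, BetaAvgAFH (stepBal N Lc − rr) (2A) γ₀ β` (the [III] side's
  weakest input form: NO (C), NO (U), NO DAG, NO run; = `AveragedAFCarrier.betaAvgAFH_of_driftRemainderConst` on the exposed drift);
* `wallEND_of_scalewise_vectorSeam_cont_allProfiles` — the [III] twin of the lead's `endpointExistence_of_scalewise_vectorSeam_cont` (v1.6): socket data, (D4) with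
  `rr < stepBal N Lc` STRICT, (C), structural `hgen` + [III] run-side `hhalt hcur`, profile data ⟹ `EndpointExistence Cn ∧ ∃ A, ∃ γ₁ > 0, ∀ γ ≤ min γ₀ γ₁, ∀ runs in
  ]0,γ], ∀ p′ ≤ p, ∀ A₀ ≥ 0: sizes ∧ HorizonFacts … (stepBal N Lc + 2A + rr) …` — NO `hup`, NO `hβ'`: the printed-type constant β′ of [III] (2.6)–(2.9) is COMPUTED;
* `flowIneq_of_scalewise_vectorSeam_cont_allProfiles` / `t4FlowInputs_of_scalewise_vectorSeam_cont` — (2.6)–(2.9) for all profiles resp. the T⁴ cell's C19/C20 at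
  `rr ≤ stepBal N Lc` from the socket data + (D4) + `0 < γ₀` + structural / run-side data ONLY: NO continuity (D5), NO upper bound (U) — the first (D5)-free
  forms on the vector road (cf. `AveragedAFCarrierScalewise` §3 on the window road).
So on the vector road (D5) `BetaContH` is needed ONLY for `EndpointExistence` / (2.46).  NO FREE LUNCH / READING CLAUSE (W-KKT-2) as in §6.  [folklore]
composition; discharges NOTHING for Bałaban's objects; NOT `BetaPertH`, NOT summit progress, never continuum / mass gap / Clay. -/

section DerivedUpper

open Literature.MathematicalPhysics.QuantumFieldTheory.Balaban1983to89.Beta.VectorLegVolumeAdapter (MvE)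
open Literature.MathematicalPhysics.QuantumFieldTheory.Balaban1983to89.Beta.DecimatedMomentSummable (AbsMoment₂)
open Literature.MathematicalPhysics.QuantumFieldTheory.Balaban1983to89.Beta.DressedMomentNormalisation (EKer m2Tensor)
open Literature.MathematicalPhysics.QuantumFieldTheory.Balaban1983to89.Beta.HidentScalewise (Tensor4 HessianTelescoping identityForm_trivial)
open Literature.MathematicalPhysics.QuantumFieldTheory.Balaban1983to89.Beta.ScalewiseVectorSeam
  (OneShotFullSum hU_of_scalewise oneLoopDrift_of_vectorTails_evenVolume)
open Literature.MathematicalPhysics.QuantumFieldTheory.Balaban1983to89.Beta.Drift (OneLoopDrift)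
open Literature.MathematicalPhysics.QuantumFieldTheory.Balaban1983to89.Beta.DriftRemainder (betaUpperH_of_drift_remainderConst upperConst_nonneg)

variable {Λ : Type*}

/-- **THE DRIFT ON THE VECTOR ROAD FROM THE SCALE-WISE SOCKET DATA** (the lead's `oneLoopDrift_of_vectorTails_evenVolume` at the trivial instance, fed by
`hU_of_scalewise`): `∃ A, OneLoopDrift (stepBal N Lc) A Sβ.β0`.  Used by the three theorems below. [folklore] -/
theorem oneLoopDrift_of_scalewise_vectorSeam (a : ℝ) (ha : 0 < a)
    (h12 : B5.Prop12Printed (fam (fun i : ℕ+ × ℕ => ((i.1 : ℕ+) : ℕ)) (fun i => i.1.pos) MvE a ha))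
    (h126 : B5.Kernel126_127Printed (kfam (fun i : ℕ+ × ℕ => ((i.1 : ℕ+) : ℕ)) MvE))
    {SL : Finset Λ} (hSL : SL.Nonempty) (k : Λ → Fin 4) {μ ν : Fin 4}
    {β : HBeta} (Sβ : B12Beta.OneLoopSplit β) (hμν : μ ≠ ν) {N : ℝ} (hN : N ≠ 0) {Lc : ℕ} [NeZero Lc] (hL : 2 ≤ Lc)
    (T 𝒯 : ℕ → EKer 4) (hTA : ∀ j c e, AbsMoment₂ (T j c e)) (hT0 : ∀ j c e, HasSum (T j c e) 0)
    (hT1 : ∀ j c e (ρ : Fin 4), HasSum (fun t : Fin 4 → ℤ => t ρ • T j c e t) 0)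
    (F : Tensor4 → ℝ) (hFadd : ∀ A B, F (A + B) = F A + F B) (hβ : ∀ j, Sβ.β0 j = F (m2Tensor (T j)))
    (htel : HessianTelescoping Lc T 𝒯)
    {U cc : ℝ} {M : ℕ → ℕ}
    (hc : 1 ≤ cc) (hM : ∀ L : ℕ, 2 ≤ L → 1 ≤ M L ∧ (L : ℝ) ≤ cc * M L) (hML : ∀ L : ℕ, 2 ≤ L → M L ≤ L)
    (hrep : OneShotFullSum Lc F 𝒯 N μ ν a SL k U)
 :
    ∃ A : ℝ, OneLoopDrift (B12Normalization.stepBal N Lc) A Sβ.β0 :=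
  oneLoopDrift_of_vectorTails_evenVolume a ha h12 h126 hSL k Sβ hμν hN hL (μC := fun j _ => Sβ.β0 j) hc hM hML
    (hU_of_scalewise hTA hT0 hT1 htel hFadd hβ hrep) (identityForm_trivial Sβ.β0)

/-- **SOCKET DATA + (D4) ⟹ THE AVERAGED-AF CARRIER** (`∃ A, BetaAvgAFH (stepBal N Lc − rr) (2A) γ₀ β`): NO (C), NO (U), NO DAG — the [III] side's weakest input
form on the vector road (`AveragedAFCarrier.betaAvgAFH_of_driftRemainderConst` on the exposed drift). [cite: Balaban1987RG1, (1.22) p.264 and (2.12)–(2.14) p.268] -/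
theorem betaAvgAFH_of_scalewise_vectorSeam (a : ℝ) (ha : 0 < a)
    (h12 : B5.Prop12Printed (fam (fun i : ℕ+ × ℕ => ((i.1 : ℕ+) : ℕ)) (fun i => i.1.pos) MvE a ha))
    (h126 : B5.Kernel126_127Printed (kfam (fun i : ℕ+ × ℕ => ((i.1 : ℕ+) : ℕ)) MvE))
    {SL : Finset Λ} (hSL : SL.Nonempty) (k : Λ → Fin 4) {μ ν : Fin 4}
    {β : HBeta} (Sβ : B12Beta.OneLoopSplit β) (hμν : μ ≠ ν) {N : ℝ} (hN : N ≠ 0) {Lc : ℕ} [NeZero Lc] (hL : 2 ≤ Lc)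
    (T 𝒯 : ℕ → EKer 4) (hTA : ∀ j c e, AbsMoment₂ (T j c e)) (hT0 : ∀ j c e, HasSum (T j c e) 0)
    (hT1 : ∀ j c e (ρ : Fin 4), HasSum (fun t : Fin 4 → ℤ => t ρ • T j c e t) 0)
    (F : Tensor4 → ℝ) (hFadd : ∀ A B, F (A + B) = F A + F B) (hβ : ∀ j, Sβ.β0 j = F (m2Tensor (T j)))
    (htel : HessianTelescoping Lc T 𝒯)
    {U cc : ℝ} {M : ℕ → ℕ}
    (hc : 1 ≤ cc) (hM : ∀ L : ℕ, 2 ≤ L → 1 ≤ M L ∧ (L : ℝ) ≤ cc * M L) (hML : ∀ L : ℕ, 2 ≤ L → M L ≤ L)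
    (hrep : OneShotFullSum Lc F 𝒯 N μ ν a SL k U)
    {rr γ₀ : ℝ} (hrem : RemainderConst Sβ γ₀ rr) :
    ∃ A : ℝ, BetaAvgAFH (B12Normalization.stepBal N Lc - rr) (2 * A) γ₀ β := by
  obtain ⟨A, hdrift⟩ := oneLoopDrift_of_scalewise_vectorSeam a ha h12 h126 hSL k Sβ hμν hN hL T 𝒯 hTA hT0 hT1 F hFadd hβ htel hc hM hML hrep
  exact ⟨A, betaAvgAFH_of_driftRemainderConst Sβ hdrift hrem⟩

/-- **THE WALL ON THE VECTOR ROAD WITH (D5) = (C) ONLY AND β′ DERIVED ⟹ THE WHOLE LOCATED [III] LIST** — the [III]-side twin of the lead's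
`ScalewiseVectorSeam.endpointExistence_of_scalewise_vectorSeam_cont` (RULING (R22)).  From EXACTLY: h12/h126 BY NAME, base-point labels, table/window data, the
scale-wise socket data (`T 𝒯 hTA hT0 hT1 F hFadd hβ htel`, `hrep : OneShotFullSum …`), (D4) `hrem` + `hr : rr < stepBal N Lc` STRICT, (C) `hcont`, `hγ₀`, the structural
`hgen` + [III] run-side `hhalt hcur`, profile data ⟹ `EndpointExistence Cn ∧ ∃ A, ∃ γ₁ > 0, …: sizes ∧ HorizonFacts … (stepBal N Lc + 2A + rr) …` — the printed-type
constant β′ of (2.6)–(2.9) COMPUTED as `stepBal N Lc + 2A + rr`, NO `hup`/`hβ'` binder.  Proof: the drift above, an4's `betaUpperH_of_drift_remainderConst` /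
`upperConst_nonneg`, `AveragedAFCarrier.betaAvgAFH_of_driftRemainderConst` + `BetaAvgAFH.endpoint_and_flowControl_allProfiles`.
[cite: Balaban1987RG1, Thm 2 p.259 and Thm 3 p.264] [cite: Balaban1988Convergent, (2.5)–(2.9) pp.255–256, (2.28) p.259, (2.46) p.263] -/
theorem wallEND_of_scalewise_vectorSeam_cont_allProfiles (a : ℝ) (ha : 0 < a)
    (h12 : B5.Prop12Printed (fam (fun i : ℕ+ × ℕ => ((i.1 : ℕ+) : ℕ)) (fun i => i.1.pos) MvE a ha))
    (h126 : B5.Kernel126_127Printed (kfam (fun i : ℕ+ × ℕ => ((i.1 : ℕ+) : ℕ)) MvE))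
    {SL : Finset Λ} (hSL : SL.Nonempty) (k : Λ → Fin 4) {μ ν : Fin 4}
    {β : HBeta} {Cn : B12.Construction} (hgen : ForwardGenerated Cn β) (hhalt : HaltsOutside Cn β) (hcur : CurriesHBeta Cn β)
    (Sβ : B12Beta.OneLoopSplit β) (hμν : μ ≠ ν) {N : ℝ} (hN : N ≠ 0) {Lc : ℕ} [NeZero Lc] (hL : 2 ≤ Lc)
    (T 𝒯 : ℕ → EKer 4) (hTA : ∀ j c e, AbsMoment₂ (T j c e)) (hT0 : ∀ j c e, HasSum (T j c e) 0)
    (hT1 : ∀ j c e (ρ : Fin 4), HasSum (fun t : Fin 4 → ℤ => t ρ • T j c e t) 0)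
    (F : Tensor4 → ℝ) (hFadd : ∀ A B, F (A + B) = F A + F B) (hβ : ∀ j, Sβ.β0 j = F (m2Tensor (T j)))
    (htel : HessianTelescoping Lc T 𝒯)
    {U cc : ℝ} {M : ℕ → ℕ}
    (hc : 1 ≤ cc) (hM : ∀ L : ℕ, 2 ≤ L → 1 ≤ M L ∧ (L : ℝ) ≤ cc * M L) (hML : ∀ L : ℕ, 2 ≤ L → M L ≤ L)
    (hrep : OneShotFullSum Lc F 𝒯 N μ ν a SL k U)
    {rr γ₀ β₀ : ℝ} (hγ₀ : 0 < γ₀) (hrem : RemainderConst Sβ γ₀ rr) (hr : rr < B12Normalization.stepBal N Lc)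
    (hcont : BetaContH γ₀ β) (hβ₀ : 0 < β₀) {L : ℕ} (hL2 : 2 ≤ L) (p : ℕ) {κ₀ : ℕ} (hκ : 6 ≤ κ₀) :
    EndpointExistence Cn ∧ ∃ A : ℝ, ∃ γ₁ : ℝ, 0 < γ₁ ∧
      ∀ γ : ℝ, 0 < γ → γ ≤ min γ₀ γ₁ → ∀ Pr : B12.RunParams, (Cn Pr).flow.InInterval γ Pr.K →
        ∀ p' : ℕ, p' ≤ p → ∀ A₀ : ℝ, 0 ≤ A₀ →
          ∃ Rj : ℕ → ℕ, (∀ j, B14.IsRj L p' ((Cn Pr).flow.g j) (Rj j)) ∧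
            HorizonFacts (Cn Pr).flow (B12Normalization.stepBal N Lc + 2 * A + rr) β₀ A₀ L p' κ₀ Rj Pr.K := by
  obtain ⟨A, hdrift⟩ := oneLoopDrift_of_scalewise_vectorSeam a ha h12 h126 hSL k Sβ hμν hN hL T 𝒯 hTA hT0 hT1 F hFadd hβ htel hc hM hML hrep
  have h := (betaAvgAFH_of_driftRemainderConst Sβ hdrift hrem).endpoint_and_flowControl_allProfiles (sub_pos.mpr hr) hgen hhalt hcur hγ₀
    (upperConst_nonneg hγ₀ hdrift hrem hr.le) hβ₀ hL2 p hcont (betaUpperH_of_drift_remainderConst Sβ hdrift hrem) hκ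
  exact ⟨h.1, A, h.2⟩

/-- **(2.6)–(2.9) FOR ALL PROFILES ON THE VECTOR ROAD WITH NEITHER (D5) NOR (U)**: socket data + (D4) with `rr ≤ stepBal N Lc` + `0 < γ₀` + structural / run-side
data ⟹ `∃ A, ∃ γ₁ > 0, ∀ γ ≤ min γ₀ γ₁, ∀ runs in ]0,γ], ∀ p′ ≤ p, ∀ A₀ ≥ 0: sizes ∧ (2.6) ∧ (2.7)_{p′} ∧ (2.8)_{A₀,p′} ∧ (2.9)` with β′ := stepBal N Lc + 2A + rr — NO
continuity, NO (2.46), NO upper-bound binder (`BetaAvgAFH.flowIneq_allProfiles`). [cite: Balaban1988Convergent, (2.5)–(2.9) pp.255–256] -/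
theorem flowIneq_of_scalewise_vectorSeam_cont_allProfiles (a : ℝ) (ha : 0 < a)
    (h12 : B5.Prop12Printed (fam (fun i : ℕ+ × ℕ => ((i.1 : ℕ+) : ℕ)) (fun i => i.1.pos) MvE a ha))
    (h126 : B5.Kernel126_127Printed (kfam (fun i : ℕ+ × ℕ => ((i.1 : ℕ+) : ℕ)) MvE))
    {SL : Finset Λ} (hSL : SL.Nonempty) (k : Λ → Fin 4) {μ ν : Fin 4}
    {β : HBeta} {Cn : B12.Construction} (hgen : ForwardGenerated Cn β) (hhalt : HaltsOutside Cn β) (hcur : CurriesHBeta Cn β)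
    (Sβ : B12Beta.OneLoopSplit β) (hμν : μ ≠ ν) {N : ℝ} (hN : N ≠ 0) {Lc : ℕ} [NeZero Lc] (hL : 2 ≤ Lc)
    (T 𝒯 : ℕ → EKer 4) (hTA : ∀ j c e, AbsMoment₂ (T j c e)) (hT0 : ∀ j c e, HasSum (T j c e) 0)
    (hT1 : ∀ j c e (ρ : Fin 4), HasSum (fun t : Fin 4 → ℤ => t ρ • T j c e t) 0)
    (F : Tensor4 → ℝ) (hFadd : ∀ A B, F (A + B) = F A + F B) (hβ : ∀ j, Sβ.β0 j = F (m2Tensor (T j)))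
    (htel : HessianTelescoping Lc T 𝒯)
    {U cc : ℝ} {M : ℕ → ℕ}
    (hc : 1 ≤ cc) (hM : ∀ L : ℕ, 2 ≤ L → 1 ≤ M L ∧ (L : ℝ) ≤ cc * M L) (hML : ∀ L : ℕ, 2 ≤ L → M L ≤ L)
    (hrep : OneShotFullSum Lc F 𝒯 N μ ν a SL k U)
    {rr γ₀ β₀ : ℝ} (hγ₀ : 0 < γ₀) (hrem : RemainderConst Sβ γ₀ rr) (hr : rr ≤ B12Normalization.stepBal N Lc)
    (hβ₀ : 0 < β₀) {L : ℕ} (hL2 : 2 ≤ L) (p : ℕ) :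
    ∃ A : ℝ, ∃ γ₁ : ℝ, 0 < γ₁ ∧
      ∀ γ : ℝ, 0 < γ → γ ≤ min γ₀ γ₁ → ∀ Pr : B12.RunParams, (Cn Pr).flow.InInterval γ Pr.K →
        ∀ p' : ℕ, p' ≤ p → ∀ A₀ : ℝ, 0 ≤ A₀ →
          ∃ Rj : ℕ → ℕ, (∀ j, B14.IsRj L p' ((Cn Pr).flow.g j) (Rj j)) ∧
            B14.FlowIneq26 (Cn Pr).flow.g (B12Normalization.stepBal N Lc + 2 * A + rr) β₀ Pr.K ∧ B14.FlowIneq27 (Cn Pr).flow.g (B12Normalization.stepBal N Lc + 2 * A + rr) β₀ p' Pr.K ∧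
            B14.FlowIneq28 (epsK A₀ p' (Cn Pr).flow) (Cn Pr).flow.g (B12Normalization.stepBal N Lc + 2 * A + rr) β₀ Pr.K ∧
            B14FlowStep.FlowIneq29 Rj (Cn Pr).flow.g L (B12Normalization.stepBal N Lc + 2 * A + rr) β₀ Pr.K := by
  obtain ⟨A, hdrift⟩ := oneLoopDrift_of_scalewise_vectorSeam a ha h12 h126 hSL k Sβ hμν hN hL T 𝒯 hTA hT0 hT1 F hFadd hβ htel hc hM hML hrep
  exact ⟨A, (betaAvgAFH_of_driftRemainderConst Sβ hdrift hrem).flowIneq_allProfiles (sub_nonneg.mpr hr) hgen hhalt hcur hγ₀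
    (upperConst_nonneg hγ₀ hdrift hrem hr) hβ₀ hL2 p (betaUpperH_of_drift_remainderConst Sβ hdrift hrem)⟩

/-- **THE T⁴ CELL's FLOW-FACT BINDERS (C19/C20) ON THE VECTOR ROAD WITH NEITHER (D5) NOR (U)** — same inputs, β′ := stepBal N Lc + 2A + rr
(`BetaAvgAFH.t4FlowInputs_of_nonneg`). [cite: Balaban1988Convergent, (2.5)–(2.9) pp.255–256] -/
theorem t4FlowInputs_of_scalewise_vectorSeam_cont (a : ℝ) (ha : 0 < a)
    (h12 : B5.Prop12Printed (fam (fun i : ℕ+ × ℕ => ((i.1 : ℕ+) : ℕ)) (fun i => i.1.pos) MvE a ha))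
    (h126 : B5.Kernel126_127Printed (kfam (fun i : ℕ+ × ℕ => ((i.1 : ℕ+) : ℕ)) MvE))
    {SL : Finset Λ} (hSL : SL.Nonempty) (k : Λ → Fin 4) {μ ν : Fin 4}
    {β : HBeta} {Cn : B12.Construction} (hgen : ForwardGenerated Cn β) (hhalt : HaltsOutside Cn β) (hcur : CurriesHBeta Cn β)
    (Sβ : B12Beta.OneLoopSplit β) (hμν : μ ≠ ν) {N : ℝ} (hN : N ≠ 0) {Lc : ℕ} [NeZero Lc] (hL : 2 ≤ Lc)
    (T 𝒯 : ℕ → EKer 4) (hTA : ∀ j c e, AbsMoment₂ (T j c e)) (hT0 : ∀ j c e, HasSum (T j c e) 0)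
    (hT1 : ∀ j c e (ρ : Fin 4), HasSum (fun t : Fin 4 → ℤ => t ρ • T j c e t) 0)
    (F : Tensor4 → ℝ) (hFadd : ∀ A B, F (A + B) = F A + F B) (hβ : ∀ j, Sβ.β0 j = F (m2Tensor (T j)))
    (htel : HessianTelescoping Lc T 𝒯)
    {U cc : ℝ} {M : ℕ → ℕ}
    (hc : 1 ≤ cc) (hM : ∀ L : ℕ, 2 ≤ L → 1 ≤ M L ∧ (L : ℝ) ≤ cc * M L) (hML : ∀ L : ℕ, 2 ≤ L → M L ≤ L)
    (hrep : OneShotFullSum Lc F 𝒯 N μ ν a SL k U)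
    {rr γ₀ β₀ : ℝ} (hγ₀ : 0 < γ₀) (hrem : RemainderConst Sβ γ₀ rr) (hr : rr ≤ B12Normalization.stepBal N Lc)
    (hβ₀ : 0 < β₀) {L : ℕ} (hL2 : 2 ≤ L) {p₀ r' : ℕ} (hr' : r' ≤ p₀) :
    ∃ A : ℝ, ∃ γ₁ : ℝ, 0 < γ₁ ∧ ∀ γ : ℝ, 0 < γ → γ ≤ min γ₀ γ₁ → ∀ Pr : B12.RunParams, (Cn Pr).flow.InInterval γ Pr.K →
      B14.FlowIneq27 (Cn Pr).flow.g (B12Normalization.stepBal N Lc + 2 * A + rr) β₀ p₀ Pr.K ∧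
      (∀ j, j ≤ Pr.K → 1 ≤ Real.log (((Cn Pr).flow.g j) ^ 2)⁻¹) ∧
      ∃ Rj : ℕ → ℕ, (∀ j, B14.IsRj L r' ((Cn Pr).flow.g j) (Rj j)) ∧
        B14FlowStep.FlowIneq29 Rj (Cn Pr).flow.g L (B12Normalization.stepBal N Lc + 2 * A + rr) β₀ Pr.K := by
  obtain ⟨A, hdrift⟩ := oneLoopDrift_of_scalewise_vectorSeam a ha h12 h126 hSL k Sβ hμν hN hL T 𝒯 hTA hT0 hT1 F hFadd hβ htel hc hM hML hrep
  exact ⟨A, (betaAvgAFH_of_driftRemainderConst Sβ hdrift hrem).t4FlowInputs_of_nonneg (sub_nonneg.mpr hr) hgen hhalt hcur hγ₀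
    (upperConst_nonneg hγ₀ hdrift hrem hr) hβ₀ hL2 hr' (betaUpperH_of_drift_remainderConst Sβ hdrift hrem)⟩

end DerivedUpper

/-! ## §9 (v1.7) RULING (R21) ON THE [III] SIDE — the EXIT-B socket IN THE KERNEL'S CONVENTION (lead `Beta/ScalewiseVectorSeam` v1.6 §8, p187481)

RULING (R21): an1's typed p. 293 predicates `WardTransversal` / `AxisReflectionCovariant` are stated in the PRINT's difference variable `z = x − y`
([Balaban1987RG1] p. 292 (5.4)/(5.5), p. 293 (5.7)/(5.8)), whereas the jet formalism's one-loop kernels (`hessKer`, an2's `TOf`/`TbalOf`) are read at `−z`; such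
families obey the MIRRORED laws (an2 `KernelReflection`), and a kernel obeying BOTH reflection laws has vanishing off-diagonal channels (the lead's
`beta0_eq_zero_of_unflipped_instantiation`).  Hence the END forms that (T-def) instantiates ask (5.9)/(5.7) of the FLIPPED kernels `fun μ ν z => T j μ ν (−z)` — the
lead's `endpointExistence_of_scalewise_vectorSeam_printed_flip` and, with RULING (R22) ((D5) := (C); the upper bound derived on the drift road), SOCKET v2
`endpointExistence_of_scalewise_vectorSeam_printed_flip_cont`.  Every slot the [III] consumers read ((T0), (T1), `AbsMoment₂`, (1.22), `D1Tel`, `D1Rep`) is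
flip-INSENSITIVE (the lead's `scalewiseData_of_printed_flip`), so the [III] side follows by ONE application each: §7's `wallEND_of_scalewise_vectorSeam_readout122_allProfiles`
fed `scalewiseData_of_printed_flip hdec hW hR` (hup/hβ′ kept), and — for SOCKET v2 — the lead's `oneLoopDrift_of_scalewise_printed_flip` fed into
`AveragedAFCarrier.betaAvgAFH_of_driftRemainderConst` with an4's `betaUpperH_of_drift_remainderConst` / `upperConst_nonneg` (β′ := stepBal N Lc + 2A + rr COMPUTED,
as in §8).  So, after brick (T-def), the [III]-side EXIT-B checklist v3 reads EXACTLY as the lead's: (i) `JetData` with Bałaban's step stencils, (ii) `hdec` + hW♭/hR♭ for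
the genuine kernels (structural, an2 P5′), (iii) `D1Tel`, (iv) `D1Rep` in `secondMoment` form — equivalently `D1Drift` (RULING (R23)) —, (v) (D4), (C), `ForwardGenerated`;
the [III] side adds `HaltsOutside`/`CurriesHBeta`, the STRICT margin and profile data, and concludes the whole located [III] list.  The unflipped §6-type twin
(`wallEND_of_scalewise_vectorSeam_printed_allProfiles`) is deliberately NOT written (nobody instantiates it, (R21-2)).  [folklore] composition; discharges NOTHING for
Bałaban's objects; NOT `BetaPertH`, NOT summit progress, never continuum / mass gap / Clay. -/

section KernelConvention

open Literature.MathematicalPhysics.QuantumFieldTheory.Balaban1983to89.Beta.VectorLegVolumeAdapter (MvE)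
open Literature.MathematicalPhysics.QuantumFieldTheory.Balaban1983to89.Beta.DressedMomentNormalisation (EKer)
open Literature.MathematicalPhysics.QuantumFieldTheory.Balaban1983to89.Beta.HidentScalewise (HessianTelescoping)
open Literature.MathematicalPhysics.QuantumFieldTheory.Balaban1983to89.Beta.ScalewiseVectorSeam
  (oneShotSide scalewiseData_of_printed_flip oneLoopDrift_of_scalewise_printed_flip)
open Literature.MathematicalPhysics.QuantumFieldTheory.Balaban1983to89.B12Beta (secondMoment)
open Literature.MathematicalPhysics.QuantumFieldTheory.Balaban1983to89.Beta.PolarizationSign (WardTransversal AxisReflectionCovariant)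
open Literature.MathematicalPhysics.QuantumFieldTheory.Balaban1983to89.Beta.Drift (OneLoopDrift)
open Literature.MathematicalPhysics.QuantumFieldTheory.Balaban1983to89.Beta.DriftRemainder (betaUpperH_of_drift_remainderConst upperConst_nonneg)

variable {Λ : Type*}

/-- **THE EXIT-B SOCKET IN THE KERNEL'S CONVENTION ⟹ THE WHOLE LOCATED [III] LIST** — the [III]-side twin of the lead's
`ScalewiseVectorSeam.endpointExistence_of_scalewise_vectorSeam_printed_flip` (RULING (R21-2); `hup`/`hβ'` kept).  Binders = the lead's VERBATIM (h12/h126 BY NAME; labels;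
table/window data; one-step / one-shot kernels `T`/`𝒯` with per-step (5.10) decay `hdec` and the printed (5.9)/(5.7) laws `hW`/`hR` asked of the FLIPPED kernels; the (1.22) read-out
`hβ`; `htel` = `D1Tel`; `hrep` = `D1Rep`; (D4) `hrem`; (D5) `hcont` + `hup`/`hβ'`) + the [III] deltas (`(hhalt) (hcur)`; `hr : rr < stepBal N Lc` STRICT; `{β₀} (hβ₀) {L} (hL2) (p) {κ₀} (hκ)`;
label type `Λ`).  Proof: §7's `wallEND_of_scalewise_vectorSeam_readout122_allProfiles` with `(hTA, hT0, hT1) := scalewiseData_of_printed_flip hdec hW hR`.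
[cite: Balaban1987RG1, Thm 2 p.259, Thm 3 p.264 and (5.7)–(5.10) p.293] [cite: Balaban1988Convergent, (2.5)–(2.9) pp.255–256, (2.28) p.259, (2.46) p.263] -/
theorem wallEND_of_scalewise_vectorSeam_printed_flip_allProfiles (a : ℝ) (ha : 0 < a)
    (h12 : B5.Prop12Printed (fam (fun i : ℕ+ × ℕ => ((i.1 : ℕ+) : ℕ)) (fun i => i.1.pos) MvE a ha))
    (h126 : B5.Kernel126_127Printed (kfam (fun i : ℕ+ × ℕ => ((i.1 : ℕ+) : ℕ)) MvE))
    {SL : Finset Λ} (hSL : SL.Nonempty) (k : Λ → Fin 4) {μ ν : Fin 4}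
    {β : HBeta} {Cn : B12.Construction} (hgen : ForwardGenerated Cn β) (hhalt : HaltsOutside Cn β) (hcur : CurriesHBeta Cn β)
    (Sβ : B12Beta.OneLoopSplit β) (hμν : μ ≠ ν) {N : ℝ} (hN : N ≠ 0) {Lc : ℕ} [NeZero Lc] (hL : 2 ≤ Lc)
    (T 𝒯 : ℕ → EKer 4)
    -- the printed p. 293 properties: (5.10) of the one-step kernels, (5.9)/(5.7) of their FLIPS (kernel convention, RULING (R21-2))
    (hdec : ∀ j, ∃ C δ : ℝ, 0 < δ ∧ ∀ μ' ν', B12Sec2to5.Decay510 (T j μ' ν') C δ)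
    (hW : ∀ j, WardTransversal (fun μ ν z => T j μ ν (-z))) (hR : ∀ j, AxisReflectionCovariant (fun μ ν z => T j μ ν (-z)))
    (hβ : ∀ j, Sβ.β0 j = secondMoment (T j) μ ν)
    (htel : HessianTelescoping Lc T 𝒯)
    {U cc : ℝ} {M : ℕ → ℕ}
    (hc : 1 ≤ cc) (hM : ∀ L : ℕ, 2 ≤ L → 1 ≤ M L ∧ (L : ℝ) ≤ cc * M L) (hML : ∀ L : ℕ, 2 ≤ L → M L ≤ L)
    (hrep : ∀ m : ℕ, 1 ≤ m → |secondMoment (𝒯 m) μ ν - oneShotSide SL μ ν N a k (Lc ^ m)| ≤ U)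
    {rr γ₀ β' β₀ : ℝ} (hγ₀ : 0 < γ₀) (hrem : RemainderConst Sβ γ₀ rr) (hr : rr < B12Normalization.stepBal N Lc)
    (hcont : BetaContH γ₀ β) (hup : BetaUpperH β' γ₀ β) (hβ' : 0 ≤ β') (hβ₀ : 0 < β₀)
    {L : ℕ} (hL2 : 2 ≤ L) (p : ℕ) {κ₀ : ℕ} (hκ : 6 ≤ κ₀) :
    EndpointExistence Cn ∧ ∃ γ₁ : ℝ, 0 < γ₁ ∧
      ∀ γ : ℝ, 0 < γ → γ ≤ min γ₀ γ₁ → ∀ Pr : B12.RunParams, (Cn Pr).flow.InInterval γ Pr.K →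
        ∀ p' : ℕ, p' ≤ p → ∀ A₀ : ℝ, 0 ≤ A₀ →
          ∃ Rj : ℕ → ℕ, (∀ j, B14.IsRj L p' ((Cn Pr).flow.g j) (Rj j)) ∧
            HorizonFacts (Cn Pr).flow β' β₀ A₀ L p' κ₀ Rj Pr.K :=
 by
  obtain ⟨hTA, hT0, hT1⟩ := scalewiseData_of_printed_flip hdec hW hR
  exact wallEND_of_scalewise_vectorSeam_readout122_allProfiles a ha h12 h126 hSL k hgen hhalt hcur Sβ hμν hN hL T 𝒯 hTA hT0 hT1 hβ htel
    hc hM hML hrep hγ₀ hrem hr hcont hup hβ' hβ₀ hL2 p hκ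

/-- **SOCKET v2 DATA + (D4) ⟹ THE AVERAGED-AF CARRIER** (kernel convention): `∃ A, BetaAvgAFH (stepBal N Lc − rr) (2A) γ₀ β` from the lead's
`oneLoopDrift_of_scalewise_printed_flip` and `AveragedAFCarrier.betaAvgAFH_of_driftRemainderConst` — NO (C), NO (U), NO DAG.
[cite: Balaban1987RG1, (1.22) p.264, (2.12)–(2.14) p.268 and (5.7)–(5.10) p.293] -/
theorem betaAvgAFH_of_scalewise_printed_flip (a : ℝ) (ha : 0 < a)
    (h12 : B5.Prop12Printed (fam (fun i : ℕ+ × ℕ => ((i.1 : ℕ+) : ℕ)) (fun i => i.1.pos) MvE a ha))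
    (h126 : B5.Kernel126_127Printed (kfam (fun i : ℕ+ × ℕ => ((i.1 : ℕ+) : ℕ)) MvE))
    {SL : Finset Λ} (hSL : SL.Nonempty) (k : Λ → Fin 4) {μ ν : Fin 4}
    {β : HBeta} (Sβ : B12Beta.OneLoopSplit β) (hμν : μ ≠ ν) {N : ℝ} (hN : N ≠ 0) {Lc : ℕ} [NeZero Lc] (hL : 2 ≤ Lc)
    (T 𝒯 : ℕ → EKer 4)
    -- the printed p. 293 properties: (5.10) of the one-step kernels, (5.9)/(5.7) of their FLIPS (kernel convention, RULING (R21-2))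
    (hdec : ∀ j, ∃ C δ : ℝ, 0 < δ ∧ ∀ μ' ν', B12Sec2to5.Decay510 (T j μ' ν') C δ)
    (hW : ∀ j, WardTransversal (fun μ ν z => T j μ ν (-z))) (hR : ∀ j, AxisReflectionCovariant (fun μ ν z => T j μ ν (-z)))
    (hβ : ∀ j, Sβ.β0 j = secondMoment (T j) μ ν)
    (htel : HessianTelescoping Lc T 𝒯)
    {U cc : ℝ} {M : ℕ → ℕ}
    (hc : 1 ≤ cc) (hM : ∀ L : ℕ, 2 ≤ L → 1 ≤ M L ∧ (L : ℝ) ≤ cc * M L) (hML : ∀ L : ℕ, 2 ≤ L → M L ≤ L)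
    (hrep : ∀ m : ℕ, 1 ≤ m → |secondMoment (𝒯 m) μ ν - oneShotSide SL μ ν N a k (Lc ^ m)| ≤ U)
    {rr γ₀ : ℝ} (hrem : RemainderConst Sβ γ₀ rr) :
    ∃ A : ℝ, BetaAvgAFH (B12Normalization.stepBal N Lc - rr) (2 * A) γ₀ β := by
  obtain ⟨A, hdrift⟩ := oneLoopDrift_of_scalewise_printed_flip a ha h12 h126 hSL k Sβ hμν hN hL T 𝒯 hdec hW hR hβ htel hc hM hML hrep
  exact ⟨A, betaAvgAFH_of_driftRemainderConst Sβ hdrift hrem⟩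

/-- **SOCKET v2 ⟹ THE WHOLE LOCATED [III] LIST, (D5) = (C) ONLY, β′ DERIVED** — the [III]-side twin of the lead's
`ScalewiseVectorSeam.endpointExistence_of_scalewise_vectorSeam_printed_flip_cont` (RULINGS (R21)/(R22)).  From EXACTLY: h12/h126 BY NAME, labels, table/window data,
`T`/`𝒯` with `hdec` + hW♭/hR♭, `hβ` (1.22), `htel` (`D1Tel`), `hrep` (`D1Rep`), (D4) `hrem` + `hr : rr < stepBal N Lc` STRICT, (C) `hcont`, `hγ₀`, structural `hgen` + [III] run-side
`hhalt hcur`, profile data — NO `hup`, NO `hβ'` ⟹ `EndpointExistence Cn ∧ ∃ A, ∃ γ₁ > 0, …: sizes ∧ HorizonFacts … (stepBal N Lc + 2A + rr) …`.  This is the [III] side of the lead's EXIT-B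
checklist v3 at the socket
level; at β⁰ := secondMoment ∘ TbalOf it is the (R23) minimal form up to the proof route.
[cite: Balaban1987RG1, Thm 2 p.259, Thm 3 p.264 and (5.7)–(5.10) p.293] [cite: Balaban1988Convergent, (2.5)–(2.9) pp.255–256, (2.28) p.259, (2.46) p.263] -/
theorem wallEND_of_scalewise_vectorSeam_printed_flip_cont_allProfiles (a : ℝ) (ha : 0 < a)
    (h12 : B5.Prop12Printed (fam (fun i : ℕ+ × ℕ => ((i.1 : ℕ+) : ℕ)) (fun i => i.1.pos) MvE a ha))
    (h126 : B5.Kernel126_127Printed (kfam (fun i : ℕ+ × ℕ => ((i.1 : ℕ+) : ℕ)) MvE))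
    {SL : Finset Λ} (hSL : SL.Nonempty) (k : Λ → Fin 4) {μ ν : Fin 4}
    {β : HBeta} {Cn : B12.Construction} (hgen : ForwardGenerated Cn β) (hhalt : HaltsOutside Cn β) (hcur : CurriesHBeta Cn β)
    (Sβ : B12Beta.OneLoopSplit β) (hμν : μ ≠ ν) {N : ℝ} (hN : N ≠ 0) {Lc : ℕ} [NeZero Lc] (hL : 2 ≤ Lc)
    (T 𝒯 : ℕ → EKer 4)
    -- the printed p. 293 properties: (5.10) of the one-step kernels, (5.9)/(5.7) of their FLIPS (kernel convention, RULING (R21-2))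
    (hdec : ∀ j, ∃ C δ : ℝ, 0 < δ ∧ ∀ μ' ν', B12Sec2to5.Decay510 (T j μ' ν') C δ)
    (hW : ∀ j, WardTransversal (fun μ ν z => T j μ ν (-z))) (hR : ∀ j, AxisReflectionCovariant (fun μ ν z => T j μ ν (-z)))
    (hβ : ∀ j, Sβ.β0 j = secondMoment (T j) μ ν)
    (htel : HessianTelescoping Lc T 𝒯)
    {U cc : ℝ} {M : ℕ → ℕ}
    (hc : 1 ≤ cc) (hM : ∀ L : ℕ, 2 ≤ L → 1 ≤ M L ∧ (L : ℝ) ≤ cc * M L) (hML : ∀ L : ℕ, 2 ≤ L → M L ≤ L)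
    (hrep : ∀ m : ℕ, 1 ≤ m → |secondMoment (𝒯 m) μ ν - oneShotSide SL μ ν N a k (Lc ^ m)| ≤ U)
    {rr γ₀ β₀ : ℝ} (hγ₀ : 0 < γ₀) (hrem : RemainderConst Sβ γ₀ rr) (hr : rr < B12Normalization.stepBal N Lc)
    (hcont : BetaContH γ₀ β) (hβ₀ : 0 < β₀) {L : ℕ} (hL2 : 2 ≤ L) (p : ℕ) {κ₀ : ℕ} (hκ : 6 ≤ κ₀) :
    EndpointExistence Cn ∧ ∃ A : ℝ, ∃ γ₁ : ℝ, 0 < γ₁ ∧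
      ∀ γ : ℝ, 0 < γ → γ ≤ min γ₀ γ₁ → ∀ Pr : B12.RunParams, (Cn Pr).flow.InInterval γ Pr.K →
        ∀ p' : ℕ, p' ≤ p → ∀ A₀ : ℝ, 0 ≤ A₀ →
          ∃ Rj : ℕ → ℕ, (∀ j, B14.IsRj L p' ((Cn Pr).flow.g j) (Rj j)) ∧
            HorizonFacts (Cn Pr).flow (B12Normalization.stepBal N Lc + 2 * A + rr) β₀ A₀ L p' κ₀ Rj Pr.K :=
 by
  obtain ⟨A, hdrift⟩ := oneLoopDrift_of_scalewise_printed_flip a ha h12 h126 hSL k Sβ hμν hN hL T 𝒯 hdec hW hR hβ htel hc hM hML hrep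
  have h := (betaAvgAFH_of_driftRemainderConst Sβ hdrift hrem).endpoint_and_flowControl_allProfiles (sub_pos.mpr hr) hgen hhalt hcur hγ₀
    (upperConst_nonneg hγ₀ hdrift hrem hr.le) hβ₀ hL2 p hcont (betaUpperH_of_drift_remainderConst Sβ hdrift hrem) hκ
  exact ⟨h.1, A, h.2⟩

/-- **SOCKET v2 DATA + (D4) ⟹ (2.6)–(2.9) FOR ALL PROFILES, NEITHER (D5) NOR (U)** (`rr ≤ stepBal N Lc`; β′ := stepBal N Lc + 2A + rr). [cite: Balaban1988Convergent, (2.5)–(2.9) pp.255–256] -/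
theorem flowIneq_of_scalewise_printed_flip_cont_allProfiles (a : ℝ) (ha : 0 < a)
    (h12 : B5.Prop12Printed (fam (fun i : ℕ+ × ℕ => ((i.1 : ℕ+) : ℕ)) (fun i => i.1.pos) MvE a ha))
    (h126 : B5.Kernel126_127Printed (kfam (fun i : ℕ+ × ℕ => ((i.1 : ℕ+) : ℕ)) MvE))
    {SL : Finset Λ} (hSL : SL.Nonempty) (k : Λ → Fin 4) {μ ν : Fin 4}
    {β : HBeta} {Cn : B12.Construction} (hgen : ForwardGenerated Cn β) (hhalt : HaltsOutside Cn β) (hcur : CurriesHBeta Cn β)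
    (Sβ : B12Beta.OneLoopSplit β) (hμν : μ ≠ ν) {N : ℝ} (hN : N ≠ 0) {Lc : ℕ} [NeZero Lc] (hL : 2 ≤ Lc)
    (T 𝒯 : ℕ → EKer 4)
    -- the printed p. 293 properties: (5.10) of the one-step kernels, (5.9)/(5.7) of their FLIPS (kernel convention, RULING (R21-2))
    (hdec : ∀ j, ∃ C δ : ℝ, 0 < δ ∧ ∀ μ' ν', B12Sec2to5.Decay510 (T j μ' ν') C δ)
    (hW : ∀ j, WardTransversal (fun μ ν z => T j μ ν (-z))) (hR : ∀ j, AxisReflectionCovariant (fun μ ν z => T j μ ν (-z)))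
    (hβ : ∀ j, Sβ.β0 j = secondMoment (T j) μ ν)
    (htel : HessianTelescoping Lc T 𝒯)
    {U cc : ℝ} {M : ℕ → ℕ}
    (hc : 1 ≤ cc) (hM : ∀ L : ℕ, 2 ≤ L → 1 ≤ M L ∧ (L : ℝ) ≤ cc * M L) (hML : ∀ L : ℕ, 2 ≤ L → M L ≤ L)
    (hrep : ∀ m : ℕ, 1 ≤ m → |secondMoment (𝒯 m) μ ν - oneShotSide SL μ ν N a k (Lc ^ m)| ≤ U)
    {rr γ₀ β₀ : ℝ} (hγ₀ : 0 < γ₀) (hrem : RemainderConst Sβ γ₀ rr) (hr : rr ≤ B12Normalization.stepBal N Lc)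
    (hβ₀ : 0 < β₀) {L : ℕ} (hL2 : 2 ≤ L) (p : ℕ) :
    ∃ A : ℝ, ∃ γ₁ : ℝ, 0 < γ₁ ∧
      ∀ γ : ℝ, 0 < γ → γ ≤ min γ₀ γ₁ → ∀ Pr : B12.RunParams, (Cn Pr).flow.InInterval γ Pr.K →
        ∀ p' : ℕ, p' ≤ p → ∀ A₀ : ℝ, 0 ≤ A₀ →
          ∃ Rj : ℕ → ℕ, (∀ j, B14.IsRj L p' ((Cn Pr).flow.g j) (Rj j)) ∧
            B14.FlowIneq26 (Cn Pr).flow.g (B12Normalization.stepBal N Lc + 2 * A + rr) β₀ Pr.K ∧ B14.FlowIneq27 (Cn Pr).flow.g (B12Normalization.stepBal N Lc + 2 * A + rr) β₀ p' Pr.K ∧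
            B14.FlowIneq28 (epsK A₀ p' (Cn Pr).flow) (Cn Pr).flow.g (B12Normalization.stepBal N Lc + 2 * A + rr) β₀ Pr.K ∧
            B14FlowStep.FlowIneq29 Rj (Cn Pr).flow.g L (B12Normalization.stepBal N Lc + 2 * A + rr) β₀ Pr.K := by
  obtain ⟨A, hdrift⟩ := oneLoopDrift_of_scalewise_printed_flip a ha h12 h126 hSL k Sβ hμν hN hL T 𝒯 hdec hW hR hβ htel hc hM hML hrep
  exact ⟨A, (betaAvgAFH_of_driftRemainderConst Sβ hdrift hrem).flowIneq_allProfiles (sub_nonneg.mpr hr) hgen hhalt hcur hγ₀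
    (upperConst_nonneg hγ₀ hdrift hrem hr) hβ₀ hL2 p (betaUpperH_of_drift_remainderConst Sβ hdrift hrem)⟩

/-- **SOCKET v2 DATA + (D4) ⟹ THE T⁴ CELL's FLOW-FACT BINDERS (C19/C20), NEITHER (D5) NOR (U)** (β′ := stepBal N Lc + 2A + rr). [cite: Balaban1988Convergent, (2.5)–(2.9) pp.255–256] -/
theorem t4FlowInputs_of_scalewise_printed_flip_cont (a : ℝ) (ha : 0 < a)
    (h12 : B5.Prop12Printed (fam (fun i : ℕ+ × ℕ => ((i.1 : ℕ+) : ℕ)) (fun i => i.1.pos) MvE a ha))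
    (h126 : B5.Kernel126_127Printed (kfam (fun i : ℕ+ × ℕ => ((i.1 : ℕ+) : ℕ)) MvE))
    {SL : Finset Λ} (hSL : SL.Nonempty) (k : Λ → Fin 4) {μ ν : Fin 4}
    {β : HBeta} {Cn : B12.Construction} (hgen : ForwardGenerated Cn β) (hhalt : HaltsOutside Cn β) (hcur : CurriesHBeta Cn β)
    (Sβ : B12Beta.OneLoopSplit β) (hμν : μ ≠ ν) {N : ℝ} (hN : N ≠ 0) {Lc : ℕ} [NeZero Lc] (hL : 2 ≤ Lc)
    (T 𝒯 : ℕ → EKer 4)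
    -- the printed p. 293 properties: (5.10) of the one-step kernels, (5.9)/(5.7) of their FLIPS (kernel convention, RULING (R21-2))
    (hdec : ∀ j, ∃ C δ : ℝ, 0 < δ ∧ ∀ μ' ν', B12Sec2to5.Decay510 (T j μ' ν') C δ)
    (hW : ∀ j, WardTransversal (fun μ ν z => T j μ ν (-z))) (hR : ∀ j, AxisReflectionCovariant (fun μ ν z => T j μ ν (-z)))
    (hβ : ∀ j, Sβ.β0 j = secondMoment (T j) μ ν)
    (htel : HessianTelescoping Lc T 𝒯)
    {U cc : ℝ} {M : ℕ → ℕ}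
    (hc : 1 ≤ cc) (hM : ∀ L : ℕ, 2 ≤ L → 1 ≤ M L ∧ (L : ℝ) ≤ cc * M L) (hML : ∀ L : ℕ, 2 ≤ L → M L ≤ L)
    (hrep : ∀ m : ℕ, 1 ≤ m → |secondMoment (𝒯 m) μ ν - oneShotSide SL μ ν N a k (Lc ^ m)| ≤ U)
    {rr γ₀ β₀ : ℝ} (hγ₀ : 0 < γ₀) (hrem : RemainderConst Sβ γ₀ rr) (hr : rr ≤ B12Normalization.stepBal N Lc)
    (hβ₀ : 0 < β₀) {L : ℕ} (hL2 : 2 ≤ L) {p₀ r' : ℕ} (hr' : r' ≤ p₀) :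
    ∃ A : ℝ, ∃ γ₁ : ℝ, 0 < γ₁ ∧ ∀ γ : ℝ, 0 < γ → γ ≤ min γ₀ γ₁ → ∀ Pr : B12.RunParams, (Cn Pr).flow.InInterval γ Pr.K →
      B14.FlowIneq27 (Cn Pr).flow.g (B12Normalization.stepBal N Lc + 2 * A + rr) β₀ p₀ Pr.K ∧
      (∀ j, j ≤ Pr.K → 1 ≤ Real.log (((Cn Pr).flow.g j) ^ 2)⁻¹) ∧
      ∃ Rj : ℕ → ℕ, (∀ j, B14.IsRj L r' ((Cn Pr).flow.g j) (Rj j)) ∧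
        B14FlowStep.FlowIneq29 Rj (Cn Pr).flow.g L (B12Normalization.stepBal N Lc + 2 * A + rr) β₀ Pr.K := by
  obtain ⟨A, hdrift⟩ := oneLoopDrift_of_scalewise_printed_flip a ha h12 h126 hSL k Sβ hμν hN hL T 𝒯 hdec hW hR hβ htel hc hM hML hrep
  exact ⟨A, (betaAvgAFH_of_driftRemainderConst Sβ hdrift hrem).t4FlowInputs_of_nonneg (sub_nonneg.mpr hr) hgen hhalt hcur hγ₀
    (upperConst_nonneg hγ₀ hdrift hrem hr) hβ₀ hL2 hr' (betaUpperH_of_drift_remainderConst Sβ hdrift hrem)⟩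

end KernelConvention

end

end Literature.MathematicalPhysics.QuantumFieldTheory.Balaban1983to89.Beta.AveragedAFCarrierVectorTails
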